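import Mathlib.Analysis.Calculus.LineDeriv.IntegrationByParts
import Mathlib.Analysis.Calculus.FDeriv.Pow
import Mathlib.Algebra.Order.Chebyshev
import Literature.Geometry.Lorentzian.CoordMetricPairDivergence
import HarnessLib

/-!
# The energy estimate for two Ricci flows on one chart (Kotschwar 2014, Prop. 7, compact case)

Static spatial part of the energy argument for the uniqueness of the Ricci flow (Kotschwar 2014,
§2.3, Prop. 7 with `α = β = 0`, `Φ ≡ 1`: "`ℰ'(t) ≤ N ℰ(t)`", for the energy
`ℰ = ∫ (|h|² + |A|² + |S|²)`; here `S` is the Ricci difference `P`, see `CoordMetricPair.lean`).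
Two fields of metric components `G, G'` on an open set `V ⊆ E` (`IsMetricOn`), a basis `b`, a
bump `ρ` (`C¹`, compactly supported in `V`), and an additive Haar measure `μ` on `E`. In the
components `H_{kl} = (G − G')(b_k,b_l)`, `A_{klm} = bᵐ(A(b_k,b_l))`, `P_{kl} = P(b_k,b_l)`,
`dP_{jkl} = DP(b_j,b_k,b_l)` we define the **energy density** `eDens = Σ H² + Σ A² + Σ P²` and its
formal time derivative along the two flows `eDeriv = −4 Σ H P + 2 Σ A ∂_tA + 2 Σ P ∂_tP`
(`∂_tA = bᵐ((Π − Π')(b_k,b_l))`, `∂_tP = ricEvolAt G − ricEvolAt G'`), and prove the **localized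
energy inequality**

  `∫ ρ² eDeriv dμ ≤ C ∫_{tsupport ρ} eDens dμ`  (`integral_rhoSq_eDeriv_le`)

with `C` depending only on the dimension, a common bound `N` of the background quantities
(`PairBound`) on `tsupport ρ`, the ellipticity constant `λ` of `g^{ij}` there, and bounds for
`ρ, Dρ`. The proof is Kotschwar's: the principal term `2 Σ P g^{ij} ∂ᵢ∂ⱼ P` and the divergence
terms `2 Σ P div U` are integrated by parts (`integral_rhoSq_mul_fderiv`, from Mathlib's
integration by parts on a finite-dimensional space), the good term `−2 ∫ ρ² g^{ij} ∂ᵢP ∂ⱼP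
≤ −2λ ∫ ρ² |∂P|²` absorbs, through Young's inequality, every term containing `∂P`, and what is
left is bounded by the energy density. Everything is proved; no definition of `Prop` type.

## References

* B. Kotschwar, *An energy approach to the problem of uniqueness for the Ricci flow*,
  Comm. Anal. Geom. 22 (2014) 149–176 (arXiv:1206.3225), §1.1 (5)–(10), §2.3, Prop. 7.
  [Kotschwar2014]
-/

noncomputable section

set_option maxSynthPendingDepth 3

open Set Filter ContinuousLinearMap Module MeasureTheory Function
open scoped Topology ContDiff

namespace Literature.Geometry.Lorentzian

namespace MetricCoord

variable {E : Type*} [NormedAddCommGroup E] [NormedSpace ℝ E]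

/-! ### Cut-off functions: continuity and integration by parts -/

section Cutoff

variable {V : Set E}

omit [NormedSpace ℝ E] in
/-- A function continuous on an open set `V` and vanishing off a closed set `C ⊆ V` is continuous.
[folklore] -/
theorem continuous_of_continuousOn_of_eq_zero (hV : IsOpen V) {C : Set E} (hC : IsClosed C)
    (hCV : C ⊆ V) {h : E → ℝ} (hcont : ContinuousOn h V) (h0 : ∀ x ∉ C, h x = 0) : Continuous h := by
  refine continuous_iff_continuousAt.2 fun x ↦ ?_
  by_cases hx : x ∈ V
  · exact hcont.continuousAt (hV.mem_nhds hx)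
  · have hxC : x ∉ C := fun h ↦ hx (hCV h)
    have hev : h =ᶠ[𝓝 x] fun _ ↦ 0 := by
      filter_upwards [hC.isOpen_compl.mem_nhds hxC] with y hy
      exact h0 y hy
    exact (continuousAt_const.congr hev.symm :)

omit [NormedSpace ℝ E] in
/-- A product `w · u` with `u` continuous on the open set `V` and `w` continuous with
`tsupport w ⊆ V` is continuous. [folklore] -/
theorem continuous_mul_of_tsupport_subset (hV : IsOpen V) {w u : E → ℝ} (hw : Continuous w)
    (hwV : tsupport w ⊆ V) (hu : ContinuousOn u V) : Continuous (fun x ↦ w x * u x) :=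
  continuous_of_continuousOn_of_eq_zero hV (isClosed_tsupport w) hwV (hw.continuousOn.mul hu)
    fun x hx ↦ by rw [image_eq_zero_of_notMem_tsupport hx, zero_mul]

omit [NormedSpace ℝ E] in
/-- Such a product has compact support if `w` has. [folklore] -/
theorem hasCompactSupport_mul_of_left {w u : E → ℝ} (hw : HasCompactSupport w) :
    HasCompactSupport (fun x ↦ w x * u x) :=
  hw.mul_right

variable [MeasurableSpace E] [BorelSpace E] [FiniteDimensional ℝ E] {μ : Measure E}
  [μ.IsAddHaarMeasure]

/-- **Integration by parts against a squared cut-off.** For `ρ` of class `C¹` with compact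
support inside the open set `V`, and `φ, ψ` of class `C¹` on `V`:
`∫ ρ² φ ∂_vψ dμ = −∫ (2ρ ∂_vρ φ + ρ² ∂_vφ) ψ dμ` (no boundary terms; Mathlib's
`integral_mul_fderiv_eq_neg_fderiv_mul_of_integrable`, all three products being continuous with
compact support). [folklore] -/
theorem integral_rhoSq_mul_fderiv (hV : IsOpen V) {ρ φ ψ : E → ℝ} (hρ : ContDiff ℝ 1 ρ)
    (hρc : HasCompactSupport ρ) (hρV : tsupport ρ ⊆ V) (hφ : ContDiffOn ℝ 1 φ V)
    (hψ : ContDiffOn ℝ 1 ψ V) (v : E) :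
    ∫ x, ρ x ^ 2 * φ x * fderiv ℝ ψ x v ∂μ =
      -∫ x, (2 * ρ x * fderiv ℝ ρ x v * φ x + ρ x ^ 2 * fderiv ℝ φ x v) * ψ x ∂μ := by
  have hρcont : Continuous ρ := hρ.continuous
  have hρd : ∀ x, HasFDerivAt ρ (fderiv ℝ ρ x) x := fun x ↦ (hρ.differentiable (by norm_num) x).hasFDerivAt
  have hDρ : Continuous (fderiv ℝ ρ) := hρ.continuous_fderiv (by norm_num)
  have hφc : ContinuousOn φ V := hφ.continuousOn
  have hψc : ContinuousOn ψ V := hψ.continuousOn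
  have hφd : ∀ x ∈ V, DifferentiableAt ℝ φ x := fun x hx ↦
    (hφ.differentiableOn (by norm_num) x hx).differentiableAt (hV.mem_nhds hx)
  have hψd : ∀ x ∈ V, DifferentiableAt ℝ ψ x := fun x hx ↦
    (hψ.differentiableOn (by norm_num) x hx).differentiableAt (hV.mem_nhds hx)
  have hDφc : ContinuousOn (fun x ↦ fderiv ℝ φ x v) V :=
    ((hφ.continuousOn_fderiv_of_isOpen hV (by norm_num)).clm_apply continuousOn_const)
  have hDψc : ContinuousOn (fun x ↦ fderiv ℝ ψ x v) V :=
    ((hψ.continuousOn_fderiv_of_isOpen hV (by norm_num)).clm_apply continuousOn_const)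
  set f : E → ℝ := fun x ↦ ρ x ^ 2 * φ x with hf
  -- the derivative of `f`, everywhere
  have hf' : ∀ x, fderiv ℝ f x v = 2 * ρ x * fderiv ℝ ρ x v * φ x + ρ x ^ 2 * fderiv ℝ φ x v := by
    intro x
    by_cases hx : x ∈ V
    · have h2 : HasFDerivAt (fun y ↦ ρ y ^ 2) (((2 : ℕ) • ρ x ^ (2 - 1)) • fderiv ℝ ρ x) x :=
        (hρd x).pow 2
      have hprod : HasFDerivAt (fun y ↦ ρ y ^ 2 * φ y) _ x := h2.fun_mul (hφd x hx).hasFDerivAt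
      rw [hprod.fderiv]
      simp only [_root_.add_apply, _root_.smul_apply, smul_eq_mul, nsmul_eq_mul, Nat.cast_ofNat,
        pow_one, Nat.add_one_sub_one]
      ring
    · have hxρ : x ∉ tsupport ρ := fun h ↦ hx (hρV h)
      have hρ0 : ρ x = 0 := image_eq_zero_of_notMem_tsupport hxρ
      have hxf : x ∉ tsupport f := by
        refine fun h ↦ hxρ ?_
        have h1 : tsupport f ⊆ tsupport (fun y ↦ ρ y ^ 2) := tsupport_mul_subset_left
        have h2 : tsupport (fun y ↦ ρ y ^ 2) ⊆ tsupport ρ := by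
          rw [show (fun y ↦ ρ y ^ 2) = fun y ↦ ρ y * ρ y from funext fun y ↦ sq (ρ y)]
          exact tsupport_mul_subset_left
        exact h2 (h1 h)
      rw [fderiv_of_notMem_tsupport ℝ hxf, _root_.zero_apply, hρ0]
      ring
  -- supports
  have hsuppf : tsupport f ⊆ tsupport ρ := by
    have h1 : tsupport f ⊆ tsupport (fun y ↦ ρ y ^ 2) := tsupport_mul_subset_left
    have h2 : tsupport (fun y ↦ ρ y ^ 2) ⊆ tsupport ρ := by
      rw [show (fun y ↦ ρ y ^ 2) = fun y ↦ ρ y * ρ y from funext fun y ↦ sq (ρ y)]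
      exact tsupport_mul_subset_left
    exact h1.trans h2
  -- continuity and compact support of the three products
  have hρ2c : Continuous fun x ↦ ρ x ^ 2 := hρcont.pow 2
  have hρ2V : tsupport (fun x ↦ ρ x ^ 2) ⊆ V := by
    rw [show (fun y ↦ ρ y ^ 2) = fun y ↦ ρ y * ρ y from funext fun y ↦ sq (ρ y)]
    exact tsupport_mul_subset_left.trans hρV
  have hρ2cs : HasCompactSupport fun x ↦ ρ x ^ 2 := by
    rw [show (fun y ↦ ρ y ^ 2) = fun y ↦ ρ y * ρ y from funext fun y ↦ sq (ρ y)]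
    exact hρc.mul_right
  have hint1 : Integrable (fun x ↦ f x * fderiv ℝ ψ x v) μ := by
    have hc : Continuous fun x ↦ ρ x ^ 2 * (φ x * fderiv ℝ ψ x v) :=
      continuous_mul_of_tsupport_subset hV hρ2c hρ2V (hφc.mul hDψc)
    have hcs : HasCompactSupport fun x ↦ ρ x ^ 2 * (φ x * fderiv ℝ ψ x v) := hρ2cs.mul_right
    exact (hc.integrable_of_hasCompactSupport hcs).congr (Eventually.of_forall fun x ↦ by
      simp only [hf]; ring)
  have hint2 : Integrable (fun x ↦ f x * ψ x) μ := by
    have hc : Continuous fun x ↦ ρ x ^ 2 * (φ x * ψ x) :=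
      continuous_mul_of_tsupport_subset hV hρ2c hρ2V (hφc.mul hψc)
    have hcs : HasCompactSupport fun x ↦ ρ x ^ 2 * (φ x * ψ x) := hρ2cs.mul_right
    exact (hc.integrable_of_hasCompactSupport hcs).congr (Eventually.of_forall fun x ↦ by
      simp only [hf]; ring)
  have hint3 : Integrable (fun x ↦ fderiv ℝ f x v * ψ x) μ := by
    have hc1 : Continuous fun x ↦ ρ x * (2 * fderiv ℝ ρ x v * φ x * ψ x) :=
      continuous_mul_of_tsupport_subset hV hρcont hρV
        (((continuousOn_const.mul (hDρ.clm_apply continuous_const).continuousOn).mul hφc).mul hψc)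
    have hc2 : Continuous fun x ↦ ρ x ^ 2 * (fderiv ℝ φ x v * ψ x) :=
      continuous_mul_of_tsupport_subset hV hρ2c hρ2V (hDφc.mul hψc)
    have hcs1 : HasCompactSupport fun x ↦ ρ x * (2 * fderiv ℝ ρ x v * φ x * ψ x) := hρc.mul_right
    have hcs2 : HasCompactSupport fun x ↦ ρ x ^ 2 * (fderiv ℝ φ x v * ψ x) := hρ2cs.mul_right
    exact ((hc1.integrable_of_hasCompactSupport hcs1).add (hc2.integrable_of_hasCompactSupport hcs2)).congr
      (Eventually.of_forall fun x ↦ by simp only [hf', Pi.add_apply]; ring)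
  have hfd : ∀ x ∈ tsupport ψ, DifferentiableAt ℝ f x := by
    intro x _
    by_cases hx : x ∈ V
    · exact ((hρd x).pow 2).differentiableAt.fun_mul (hφd x hx)
    · have hxf : x ∉ tsupport f := fun h ↦ hx (hρV (hsuppf h))
      exact (HasFDerivAt.of_notMem_tsupport ℝ hxf).differentiableAt
  have hgd : ∀ x ∈ tsupport f, DifferentiableAt ℝ ψ x := fun x hx ↦ hψd x (hρV (hsuppf hx))
  have key := integral_mul_fderiv_eq_neg_fderiv_mul_of_integrable hint3 hint1 hint2 hfd hgd
  change ∫ x, f x * fderiv ℝ ψ x v ∂μ = _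
  rw [key]
  congr 1
  exact integral_congr_ae (Eventually.of_forall fun x ↦ by simp only [hf' x])

end Cutoff

/-! ### Components in a basis and the comparison with operator norms -/

section Components

variable {ι : Type*} [Fintype ι] [FiniteDimensional ℝ E] (b : Basis ι ℝ E) {N : ℝ}

/-- **A bilinear form is bounded by its components**: if `‖bᵏ‖ ≤ N` for the dual basis, then
`‖T‖ ≤ N² Σ_{kl} |T(b_k, b_l)|`. [folklore] -/
theorem norm_le_sum_abs_apply₂ (hN0 : 0 ≤ N) (hN : ∀ i, ‖coordCLM b i‖ ≤ N) (T : E →L[ℝ] E →L[ℝ] ℝ) :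
    ‖T‖ ≤ N ^ 2 * ∑ k, ∑ l, |T (b k) (b l)| := by
  refine ContinuousLinearMap.opNorm_le_bound₂ _ (by positivity) fun v w ↦ ?_
  have hv : ∀ k, |b.coord k v| ≤ N * ‖v‖ := fun k ↦ by
    rw [← coordCLM_apply, ← Real.norm_eq_abs]; exact (le_opNorm _ _).trans (by gcongr; exact hN k)
  have hw : ∀ l, |b.coord l w| ≤ N * ‖w‖ := fun l ↦ by
    rw [← coordCLM_apply, ← Real.norm_eq_abs]; exact (le_opNorm _ _).trans (by gcongr; exact hN l)
  have hexp : T v w = ∑ k, ∑ l, b.coord k v * b.coord l w * T (b k) (b l) := by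
    conv_lhs => rw [← b.sum_repr v, ← b.sum_repr w]
    simp only [map_sum, map_smul, FunLike.coe_sum, Finset.sum_apply, _root_.smul_apply, smul_eq_mul,
      Basis.coord_apply, Finset.mul_sum]
    rw [Finset.sum_comm]
    refine Finset.sum_congr rfl fun k _ ↦ Finset.sum_congr rfl fun l _ ↦ by ring
  rw [Real.norm_eq_abs, hexp]
  calc |∑ k, ∑ l, b.coord k v * b.coord l w * T (b k) (b l)|
      ≤ ∑ k, ∑ l, |b.coord k v * b.coord l w * T (b k) (b l)| :=
        (Finset.abs_sum_le_sum_abs _ _).trans (Finset.sum_le_sum fun k _ ↦ Finset.abs_sum_le_sum_abs _ _)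
    _ ≤ ∑ k, ∑ l, (N * ‖v‖) * (N * ‖w‖) * |T (b k) (b l)| := by
        refine Finset.sum_le_sum fun k _ ↦ Finset.sum_le_sum fun l _ ↦ ?_
        rw [abs_mul, abs_mul]
        gcongr
        · exact hv k
        · exact hw l
    _ = N ^ 2 * (∑ k, ∑ l, |T (b k) (b l)|) * ‖v‖ * ‖w‖ := by
        simp only [Finset.mul_sum, Finset.sum_mul]
        refine Finset.sum_congr rfl fun k _ ↦ Finset.sum_congr rfl fun l _ ↦ by ring

/-- **A trilinear form is bounded by its components**: `‖T‖ ≤ N³ Σ_{jkl} |T(b_j, b_k, b_l)|`.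
[folklore] -/
theorem norm_le_sum_abs_apply₃ (hN0 : 0 ≤ N) (hN : ∀ i, ‖coordCLM b i‖ ≤ N)
    (T : E →L[ℝ] E →L[ℝ] E →L[ℝ] ℝ) :
    ‖T‖ ≤ N ^ 3 * ∑ j, ∑ k, ∑ l, |T (b j) (b k) (b l)| := by
  refine ContinuousLinearMap.opNorm_le_bound _ (by positivity) fun u ↦ ?_
  have hu : ∀ j, |b.coord j u| ≤ N * ‖u‖ := fun j ↦ by
    rw [← coordCLM_apply, ← Real.norm_eq_abs]; exact (le_opNorm _ _).trans (by gcongr; exact hN j)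
  have hexp : T u = ∑ j, b.coord j u • T (b j) := by
    conv_lhs => rw [← b.sum_repr u]
    simp only [map_sum, map_smul, Basis.coord_apply]
  rw [hexp]
  calc ‖∑ j, b.coord j u • T (b j)‖ ≤ ∑ j, ‖b.coord j u • T (b j)‖ := norm_sum_le _ _
    _ ≤ ∑ j, (N * ‖u‖) * (N ^ 2 * ∑ k, ∑ l, |T (b j) (b k) (b l)|) := by
        refine Finset.sum_le_sum fun j _ ↦ ?_
        rw [norm_smul, Real.norm_eq_abs]
        exact mul_le_mul (hu j) (norm_le_sum_abs_apply₂ b hN0 hN (T (b j))) (norm_nonneg _) (by positivity)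
    _ = N ^ 3 * (∑ j, ∑ k, ∑ l, |T (b j) (b k) (b l)|) * ‖u‖ := by
        simp only [Finset.mul_sum, Finset.sum_mul]
        refine Finset.sum_congr rfl fun j _ ↦ Finset.sum_congr rfl fun k _ ↦
          Finset.sum_congr rfl fun l _ ↦ by ring

/-- **A vector-valued bilinear map is bounded by its components**: with `‖b_m‖, ‖bᵐ‖ ≤ N`,
`‖A‖ ≤ N³ Σ_{klm} |bᵐ(A(b_k, b_l))|`. [folklore] -/
theorem norm_le_sum_abs_coord_apply₂ (hN0 : 0 ≤ N) (hN : ∀ i, ‖coordCLM b i‖ ≤ N)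
    (hN' : ∀ i, ‖b i‖ ≤ N) (A : E →L[ℝ] E →L[ℝ] E) :
    ‖A‖ ≤ N ^ 3 * ∑ k, ∑ l, ∑ m, |coordCLM b m (A (b k) (b l))| := by
  refine ContinuousLinearMap.opNorm_le_bound₂ _ (by positivity) fun v w ↦ ?_
  have hv : ∀ k, |b.coord k v| ≤ N * ‖v‖ := fun k ↦ by
    rw [← coordCLM_apply, ← Real.norm_eq_abs]; exact (le_opNorm _ _).trans (by gcongr; exact hN k)
  have hw : ∀ l, |b.coord l w| ≤ N * ‖w‖ := fun l ↦ by
    rw [← coordCLM_apply, ← Real.norm_eq_abs]; exact (le_opNorm _ _).trans (by gcongr; exact hN l)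
  have hvec : ∀ k l, ‖A (b k) (b l)‖ ≤ N * ∑ m, |coordCLM b m (A (b k) (b l))| := by
    intro k l
    conv_lhs => rw [← b.sum_repr (A (b k) (b l))]
    calc ‖∑ m, b.repr (A (b k) (b l)) m • b m‖ ≤ ∑ m, ‖b.repr (A (b k) (b l)) m • b m‖ := norm_sum_le _ _
      _ ≤ ∑ m, |coordCLM b m (A (b k) (b l))| * N := by
          refine Finset.sum_le_sum fun m _ ↦ ?_
          rw [norm_smul, Real.norm_eq_abs, coordCLM_apply, Basis.coord_apply]
          gcongr
          exact hN' m
      _ = N * ∑ m, |coordCLM b m (A (b k) (b l))| := by rw [Finset.mul_sum]; exact Finset.sum_congr rfl fun m _ ↦ by ring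
  have hexp : A v w = ∑ k, ∑ l, (b.coord k v * b.coord l w) • A (b k) (b l) := by
    conv_lhs => rw [← b.sum_repr v, ← b.sum_repr w]
    simp only [map_sum, map_smul, FunLike.coe_sum, Finset.sum_apply, _root_.smul_apply,
      Basis.coord_apply, Finset.smul_sum, smul_smul]
    rw [Finset.sum_comm]
    refine Finset.sum_congr rfl fun k _ ↦ Finset.sum_congr rfl fun l _ ↦ by rw [mul_comm]
  rw [hexp]
  calc ‖∑ k, ∑ l, (b.coord k v * b.coord l w) • A (b k) (b l)‖
      ≤ ∑ k, ∑ l, ‖(b.coord k v * b.coord l w) • A (b k) (b l)‖ :=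
        (norm_sum_le _ _).trans (Finset.sum_le_sum fun k _ ↦ norm_sum_le _ _)
    _ ≤ ∑ k, ∑ l, (N * ‖v‖) * (N * ‖w‖) * (N * ∑ m, |coordCLM b m (A (b k) (b l))|) := by
        refine Finset.sum_le_sum fun k _ ↦ Finset.sum_le_sum fun l _ ↦ ?_
        rw [norm_smul, Real.norm_eq_abs, abs_mul]
        gcongr
        · exact hv k
        · exact hw l
        · exact hvec k l
    _ = N ^ 3 * (∑ k, ∑ l, ∑ m, |coordCLM b m (A (b k) (b l))|) * ‖v‖ * ‖w‖ := by
        simp only [Finset.mul_sum, Finset.sum_mul]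
        refine Finset.sum_congr rfl fun k _ ↦ Finset.sum_congr rfl fun l _ ↦
          Finset.sum_congr rfl fun m _ ↦ by ring

/-- **Young's inequality** in the form `|a| |c| ≤ (δ/2) a² + (1/(2δ)) c²`. [folklore] -/
theorem abs_mul_abs_le_young {δ : ℝ} (hδ : 0 < δ) (a c : ℝ) :
    |a| * |c| ≤ δ / 2 * a ^ 2 + 1 / (2 * δ) * c ^ 2 := by
  have h := two_mul_le_add_sq (δ * |a|) |c|
  rw [mul_pow, sq_abs, sq_abs] at h
  have h2δ : 0 < 2 * δ := by positivity
  have key : 2 * δ * (|a| * |c|) ≤ 2 * δ * (δ / 2 * a ^ 2 + 1 / (2 * δ) * c ^ 2) := by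
    have h1 : 2 * δ * (δ / 2 * a ^ 2 + 1 / (2 * δ) * c ^ 2) = δ ^ 2 * a ^ 2 + c ^ 2 := by
      field_simp
    rw [h1]
    nlinarith [h]
  exact le_of_mul_le_mul_left key h2δ

end Components

/-! ### The energy density, its formal time derivative, and the integrands after integration by parts -/

section Definitions

variable {ι : Type*} [Fintype ι] [FiniteDimensional ℝ E] [CompleteSpace E] (b : Basis ι ℝ E)
  (G G' : E → E →L[ℝ] E →L[ℝ] ℝ)

/-- Components of `H = G − G'`: `H_{kl} = (G − G')(b_k, b_l)`. [cite: Kotschwar2014, §1.1] -/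
def hComp (x : E) (p : ι × ι) : ℝ := (G x - G' x) (b p.1) (b p.2)

/-- Components of `A = Γ − Γ'`: `A_{klm} = bᵐ(A(b_k, b_l))`. [cite: Kotschwar2014, §1.1] -/
def aComp (x : E) (t : ι × ι × ι) : ℝ := coordCLM b t.2.2 (chrDiff G G' x (b t.1) (b t.2.1))

/-- Components of `P = Ric − Ric'`: `P_{kl} = P(b_k, b_l)`. [cite: Kotschwar2014, §1.1] -/
def pComp (x : E) (p : ι × ι) : ℝ := ricDiff G G' x (b p.1) (b p.2)

/-- Components of `DP`: `dP_{jkl} = DP(b_j)(b_k, b_l)`. [cite: Kotschwar2014, §1.1] -/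
def dpComp (x : E) (t : ι × ι × ι) : ℝ := fderiv ℝ (ricDiff G G') x (b t.1) (b t.2.1) (b t.2.2)

/-- Components of `∂_t A = Π − Π'`: `bᵐ((Π − Π')(b_k, b_l))`. [cite: Kotschwar2014, §1.1 (6)] -/
def piComp (x : E) (t : ι × ι × ι) : ℝ :=
  coordCLM b t.2.2 ((piFlowAt G x - piFlowAt G' x) (b t.1) (b t.2.1))

/-- **The energy density** `e = Σ H² + Σ A² + Σ P²` (Kotschwar's integrand `|h|² + |A|² + |S|²` in
components, compact case `α = β = 0`). [cite: Kotschwar2014, §2.2] -/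
def eDens (x : E) : ℝ :=
  ∑ p, hComp b G G' x p ^ 2 + ∑ t, aComp b G G' x t ^ 2 + ∑ p, pComp b G G' x p ^ 2

/-- The gradient density `q = Σ (dP)²` (Kotschwar's `|∇S|²`). [cite: Kotschwar2014, §2.3] -/
def qDens (x : E) : ℝ := ∑ t, dpComp b G G' x t ^ 2

/-- **The formal time derivative of the energy density along the two flows**:
`−4 Σ H P + 2 Σ A (Π − Π') + 2 Σ P (Λ(G) − Λ(G'))` (`∂_t H = −2P`, `∂_t A = Π − Π'`,
`∂_t P = ricEvolAt G − ricEvolAt G'`). [cite: Kotschwar2014, §2.3] -/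
def eDeriv (x : E) : ℝ :=
  ∑ p, 2 * hComp b G G' x p * (-2 * pComp b G G' x p)
    + ∑ t, 2 * aComp b G G' x t * piComp b G G' x t
    + ∑ p, 2 * pComp b G G' x p *
        (ricEvolAt b G x (b p.1) (b p.2) - ricEvolAt b G' x (b p.1) (b p.2))

/-- The residual of `Λ(G) − Λ(G')` after removing the principal part and the divergence of the
potentials; on `V` it equals `fRaw − divCorr` (`resComp_eq`). [cite: Kotschwar2014, §1.1 (8)] -/
def resComp (x : E) (p : ι × ι) : ℝ :=
  (ricEvolAt b G x (b p.1) (b p.2) - ricEvolAt b G' x (b p.1) (b p.2))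
    - (∑ i, ∑ j, ginv G b x i j * fderiv ℝ (fderiv ℝ (ricDiff G G')) x (b i) (b j) (b p.1) (b p.2))
    - ((∑ i, fderiv ℝ (uPot b G G' (b p.1) (b p.2) i) x (b i))
      + fderiv ℝ (vPot b G G' (b p.2)) x (b p.1) + fderiv ℝ (vPot b G G' (b p.1)) x (b p.2))

variable (ρ : E → ℝ)

/-- The part of `ρ² eDeriv` not integrated by parts. [cite: Kotschwar2014, §2.3] -/
def phi0 (x : E) : ℝ :=
  ρ x ^ 2 * (∑ p, 2 * hComp b G G' x p * (-2 * pComp b G G' x p)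
    + ∑ t, 2 * aComp b G G' x t * piComp b G G' x t
    + ∑ p, 2 * pComp b G G' x p * resComp b G G' x p)

/-- The principal part after integration by parts:
`−Σ [2ρ ∂ᵢρ (2 g^{ij} P) + ρ² · 2 (∂ᵢg^{ij} P + g^{ij} ∂ᵢP)] ∂ⱼP`. [cite: Kotschwar2014, §2.3] -/
def phiPr (x : E) : ℝ :=
  -∑ p, ∑ i, ∑ j, (2 * ρ x * fderiv ℝ ρ x (b i) * (2 * (ginv G b x i j * pComp b G G' x p))
      + ρ x ^ 2 * (2 * (dginv b G x (b i) i j * pComp b G G' x p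
        + ginv G b x i j * dpComp b G G' x (i, p)))) * dpComp b G G' x (j, p)

/-- The divergence part after integration by parts:
`−Σ [2ρ ∂ρ (2P) + ρ² (2 ∂P)] · (potentials)`. [cite: Kotschwar2014, §2.3] -/
def phiDv (x : E) : ℝ :=
  -∑ p, ((∑ i, (2 * ρ x * fderiv ℝ ρ x (b i) * (2 * pComp b G G' x p)
        + ρ x ^ 2 * (2 * dpComp b G G' x (i, p))) * uPot b G G' (b p.1) (b p.2) i x)
      + (2 * ρ x * fderiv ℝ ρ x (b p.1) * (2 * pComp b G G' x p)
        + ρ x ^ 2 * (2 * dpComp b G G' x (p.1, p))) * vPot b G G' (b p.2) x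
      + (2 * ρ x * fderiv ℝ ρ x (b p.2) * (2 * pComp b G G' x p)
        + ρ x ^ 2 * (2 * dpComp b G G' x (p.2, p))) * vPot b G G' (b p.1) x)

end Definitions

/-! ### The residual on `V`; continuity of the ingredients -/

section Continuity

variable {ι : Type*} [Fintype ι] [FiniteDimensional ℝ E] [CompleteSpace E] {b : Basis ι ℝ E}
  {G G' : E → E →L[ℝ] E →L[ℝ] ℝ} {V : Set E} {x : E}

/-- On `V`, `resComp = fRaw − divCorr`. [cite: Kotschwar2014, §1.1 (8)] -/
theorem IsMetricOn.resComp_eq (hG : IsMetricOn G V) (hG' : IsMetricOn G' V) (hx : x ∈ V) (p : ι × ι) :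
    resComp b G G' x p = fRaw b G G' x (b p.1) (b p.2) - divCorr b G G' x (b p.1) (b p.2) := by
  rw [resComp, hG.ricEvolAt_sub b hG' hx, hG.divRaw_eq hG' hx]
  ring

/-- `y ↦ (∇Ric)_y` is continuous on `V` as a map into trilinear forms. [folklore] -/
theorem IsMetricOn.continuousOn_cov₂At_ricAt (hG : IsMetricOn G V) :
    ContinuousOn (cov₂At G (ricAt G)) V :=
  hG.contDiffOn_cov₂At_ricAt.continuousOn

/-- `y ↦ piFlowAt G y` is continuous on `V`. [folklore] -/
theorem IsMetricOn.continuousOn_piFlowAt (hG : IsMetricOn G V) : ContinuousOn (piFlowAt G) V := by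
  have hC := hG.continuousOn_cov₂At_ricAt
  have hS : ContinuousOn (sharpAt G) V := hG.contDiffOn_sharpAt.continuousOn
  have hκ : ContinuousOn (kappaAt G) V := by
    have h1 : ContinuousOn (fun y ↦ swap₁₂ (cov₂At G (ricAt G) y)) V :=
      (swap₁₂ (E := E)).continuous.comp_continuousOn hC
    have h2 : ContinuousOn (fun y ↦ swap₂₃ (swap₁₂ (cov₂At G (ricAt G) y))) V :=
      (swap₂₃ (E := E)).continuous.comp_continuousOn h1
    exact (hC.add h1).sub h2
  have hL : ContinuousOn (fun y ↦ ContinuousLinearMap.compL ℝ E (E →L[ℝ] ℝ) E (sharpAt G y)) V :=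
    (ContinuousLinearMap.compL ℝ E (E →L[ℝ] ℝ) E).continuous.comp_continuousOn hS
  exact (hL.clm_comp hκ).neg

omit [Fintype ι] [FiniteDimensional ℝ E] [CompleteSpace E] in
/-- The components `hComp` are continuous on `V`. [folklore] -/
theorem IsMetricOn.continuousOn_hComp (hG : IsMetricOn G V) (hG' : IsMetricOn G' V) (p : ι × ι) :
    ContinuousOn (fun y ↦ hComp b G G' y p) V :=
  ((hG.contDiffOn.sub hG'.contDiffOn).continuousOn.clm_apply continuousOn_const).clm_apply
    continuousOn_const

omit [Fintype ι] in
/-- The components `aComp` are continuous on `V`. [folklore] -/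
theorem IsMetricOn.continuousOn_aComp (hG : IsMetricOn G V) (hG' : IsMetricOn G' V) (t : ι × ι × ι) :
    ContinuousOn (fun y ↦ aComp b G G' y t) V :=
  (coordCLM b t.2.2).continuous.comp_continuousOn
    (((hG.contDiffOn_chrDiff hG').continuousOn.clm_apply continuousOn_const).clm_apply continuousOn_const)

omit [Fintype ι] in
/-- The components `pComp` are continuous on `V`. [folklore] -/
theorem IsMetricOn.continuousOn_pComp (hG : IsMetricOn G V) (hG' : IsMetricOn G' V) (p : ι × ι) :
    ContinuousOn (fun y ↦ pComp b G G' y p) V :=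
  ((hG.contDiffOn_ricDiff hG').continuousOn.clm_apply continuousOn_const).clm_apply continuousOn_const

omit [Fintype ι] in
/-- The components `dpComp` are continuous on `V`. [folklore] -/
theorem IsMetricOn.continuousOn_dpComp (hG : IsMetricOn G V) (hG' : IsMetricOn G' V) (t : ι × ι × ι) :
    ContinuousOn (fun y ↦ dpComp b G G' y t) V :=
  ((((hG.contDiffOn_ricDiff hG').continuousOn_fderiv_of_isOpen hG.isOpen (by simp)).clm_apply
    continuousOn_const).clm_apply continuousOn_const).clm_apply continuousOn_const

omit [Fintype ι] in
/-- The second derivatives `D²P(bᵢ,bⱼ)(b_k,b_l)` are continuous on `V`. [folklore] -/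
theorem IsMetricOn.continuousOn_ddP (hG : IsMetricOn G V) (hG' : IsMetricOn G' V) (i j k l : ι) :
    ContinuousOn (fun y ↦ fderiv ℝ (fderiv ℝ (ricDiff G G')) y (b i) (b j) (b k) (b l)) V := by
  have h := ((hG.contDiffOn_ricDiff hG').fderiv_of_isOpen hG.isOpen (m := ∞) (by simp)).continuousOn_fderiv_of_isOpen
    hG.isOpen (by simp)
  exact (((h.clm_apply continuousOn_const).clm_apply continuousOn_const).clm_apply continuousOn_const).clm_apply
    continuousOn_const

omit [Fintype ι] in
/-- The components `piComp` are continuous on `V`. [folklore] -/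
theorem IsMetricOn.continuousOn_piComp (hG : IsMetricOn G V) (hG' : IsMetricOn G' V) (t : ι × ι × ι) :
    ContinuousOn (fun y ↦ piComp b G G' y t) V :=
  (coordCLM b t.2.2).continuous.comp_continuousOn
    (((hG.continuousOn_piFlowAt.sub hG'.continuousOn_piFlowAt).clm_apply continuousOn_const).clm_apply
      continuousOn_const)

omit [Fintype ι] in
/-- `y ↦ ∂_W g^{ij}(y)` is continuous on `V`. [folklore] -/
theorem IsMetricOn.continuousOn_dginv (hG : IsMetricOn G V) (W : E) (i j : ι) :
    ContinuousOn (fun y ↦ dginv b G y W i j) V :=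
  (coordCLM b i).continuous.comp_continuousOn
    (((hG.contDiffOn_sharpAt.continuousOn_fderiv_of_isOpen hG.isOpen (by simp)).clm_apply
      continuousOn_const).clm_apply continuousOn_const)

/-- `y ↦ g^{ij}(y)` is continuous on `V`. [folklore] -/
theorem IsMetricOn.continuousOn_ginv (hG : IsMetricOn G V) (i j : ι) :
    ContinuousOn (fun y ↦ ginv G b y i j) V :=
  (hG.contDiffOn_ginv b i j).continuousOn

/-- `y ↦ ricEvolAt b G y Y Z` is continuous on `V`. [folklore] -/
theorem IsMetricOn.continuousOn_ricEvolAt (hG : IsMetricOn G V) (Y Z : E) :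
    ContinuousOn (fun y ↦ ricEvolAt b G y Y Z) V := by
  have hC : ContinuousOn (cov₂At G (ricAt G)) V := hG.continuousOn_cov₂At_ricAt
  have hDC : ContinuousOn (fderiv ℝ (cov₂At G (ricAt G))) V :=
    hG.contDiffOn_cov₂At_ricAt.continuousOn_fderiv_of_isOpen hG.isOpen (by simp)
  have hΓ : ContinuousOn (chrAt G) V := hG.contDiffOn_chrAt.continuousOn
  have hR : ContinuousOn (ricAt G) V := hG.contDiffOn_ricAt.continuousOn
  have hRm : ∀ W Y Z, ContinuousOn (fun y ↦ riemAt G y W Y Z) V := fun W Y Z ↦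
    (hG.contDiffOn_riemAt_apply W Y Z).continuousOn
  have hg := fun i j ↦ hG.continuousOn_ginv (b := b) i j
  -- the Laplacian part
  have hlap : ContinuousOn (fun y ↦ lapBilinAt G (ricAt G) y Y Z) V := by
    have heq : (fun y ↦ lapBilinAt G (ricAt G) y Y Z) = fun y ↦ ∑ k, ∑ l, ginv G b y k l *
        (fderiv ℝ (cov₂At G (ricAt G)) y (b k) (b l) Y Z - cov₂At G (ricAt G) y (chrAt G y (b k) (b l)) Y Z
          - cov₂At G (ricAt G) y (b l) (chrAt G y (b k) Y) Z - cov₂At G (ricAt G) y (b l) Y (chrAt G y (b k) Z)) := by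
      funext y
      rw [lapBilinAt_apply_eq_sum G (ricAt G) b]
      simp only [cov₃At_apply]
    rw [heq]
    refine continuousOn_finsetSum _ fun k _ ↦ continuousOn_finsetSum _ fun l _ ↦ (hg k l).mul ?_
    refine ((ContinuousOn.sub (ContinuousOn.sub ?_ ?_) ?_).sub ?_)
    · exact (((hDC.clm_apply continuousOn_const).clm_apply continuousOn_const).clm_apply
        continuousOn_const).clm_apply continuousOn_const
    · exact ((hC.clm_apply ((hΓ.clm_apply continuousOn_const).clm_apply continuousOn_const)).clm_apply
        continuousOn_const).clm_apply continuousOn_const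
    · exact ((hC.clm_apply continuousOn_const).clm_apply
        ((hΓ.clm_apply continuousOn_const).clm_apply continuousOn_const)).clm_apply continuousOn_const
    · exact ((hC.clm_apply continuousOn_const).clm_apply continuousOn_const).clm_apply
        ((hΓ.clm_apply continuousOn_const).clm_apply continuousOn_const)
  -- the reaction part
  have hreact : ContinuousOn (fun y ↦ ricReactAt b G y Y Z) V := by
    unfold ricReactAt reactTerm
    refine continuousOn_finsetSum _ fun i _ ↦ continuousOn_finsetSum _ fun j _ ↦ (hg i j).mul ?_
    refine ((ContinuousOn.add (ContinuousOn.add ?_ ?_) ?_).add ?_)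
    · exact (hR.clm_apply (hRm _ _ _)).clm_apply continuousOn_const
    · exact (hR.clm_apply (hRm _ _ _)).clm_apply continuousOn_const
    · exact (hR.clm_apply continuousOn_const).clm_apply (hRm _ _ _)
    · exact (hR.clm_apply continuousOn_const).clm_apply (hRm _ _ _)
  exact hlap.add hreact

/-- The residual `resComp` is continuous on `V`. [folklore] -/
theorem IsMetricOn.continuousOn_resComp (hG : IsMetricOn G V) (hG' : IsMetricOn G' V) (p : ι × ι) :
    ContinuousOn (fun y ↦ resComp b G G' y p) V := by
  have hu : ∀ i, ContinuousOn (fun y ↦ fderiv ℝ (uPot b G G' (b p.1) (b p.2) i) y (b i)) V := fun i ↦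
    ((hG.contDiffOn_uPot hG' (b p.1) (b p.2) i).continuousOn_fderiv_of_isOpen hG.isOpen (by simp)).clm_apply
      continuousOn_const
  have hv : ∀ (W d : E), ContinuousOn (fun y ↦ fderiv ℝ (vPot b G G' W) y d) V := fun W d ↦
    ((hG.contDiffOn_vPot hG' W).continuousOn_fderiv_of_isOpen hG.isOpen (by simp)).clm_apply continuousOn_const
  unfold resComp
  refine ((((hG.continuousOn_ricEvolAt (b p.1) (b p.2)).sub (hG'.continuousOn_ricEvolAt (b p.1) (b p.2))).sub
    ?_).sub ?_)
  · exact continuousOn_finsetSum _ fun i _ ↦ continuousOn_finsetSum _ fun j _ ↦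
      (hG.continuousOn_ginv i j).mul (hG.continuousOn_ddP hG' i j p.1 p.2)
  · exact ((continuousOn_finsetSum _ fun i _ ↦ hu i).add (hv _ _)).add (hv _ _)

end Continuity

/-! ### Integrability against the cut-off and the integration by parts of the energy terms -/

section Integrals

variable [MeasurableSpace E] [BorelSpace E] {μ : Measure E} {ι : Type*} [Fintype ι] [FiniteDimensional ℝ E]
  [μ.IsAddHaarMeasure] [CompleteSpace E] {b : Basis ι ℝ E} {G G' : E → E →L[ℝ] E →L[ℝ] ℝ} {V : Set E}
  {ρ : E → ℝ}

omit [Fintype ι] [CompleteSpace E] [FiniteDimensional ℝ E] in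
/-- `ρ² u` is integrable for `u` continuous on `V ⊇ tsupport ρ`. [folklore] -/
theorem integrable_rhoSq_mul (hV : IsOpen V) (hρ : ContDiff ℝ 1 ρ) (hρc : HasCompactSupport ρ)
    (hρV : tsupport ρ ⊆ V) {u : E → ℝ} (hu : ContinuousOn u V) :
    Integrable (fun x ↦ ρ x ^ 2 * u x) μ := by
  have hρ2V : tsupport (fun x ↦ ρ x ^ 2) ⊆ V := by
    rw [show (fun y ↦ ρ y ^ 2) = fun y ↦ ρ y * ρ y from funext fun y ↦ sq (ρ y)]
    exact tsupport_mul_subset_left.trans hρV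
  have hρ2cs : HasCompactSupport fun x ↦ ρ x ^ 2 := by
    rw [show (fun y ↦ ρ y ^ 2) = fun y ↦ ρ y * ρ y from funext fun y ↦ sq (ρ y)]
    exact hρc.mul_right
  exact (continuous_mul_of_tsupport_subset hV (hρ.continuous.pow 2) hρ2V hu).integrable_of_hasCompactSupport
    hρ2cs.mul_right

omit [Fintype ι] [CompleteSpace E] [FiniteDimensional ℝ E] in
/-- `ρ ∂_vρ u` is integrable for `u` continuous on `V ⊇ tsupport ρ`. [folklore] -/
theorem integrable_rho_drho_mul (hV : IsOpen V) (hρ : ContDiff ℝ 1 ρ) (hρc : HasCompactSupport ρ)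
    (hρV : tsupport ρ ⊆ V) {u : E → ℝ} (hu : ContinuousOn u V) (v : E) :
    Integrable (fun x ↦ ρ x * fderiv ℝ ρ x v * u x) μ := by
  have hDρ : Continuous (fun x ↦ fderiv ℝ ρ x v) := (hρ.continuous_fderiv (by norm_num)).clm_apply continuous_const
  have hc : Continuous fun x ↦ ρ x * (fderiv ℝ ρ x v * u x) :=
    continuous_mul_of_tsupport_subset hV hρ.continuous hρV (hDρ.continuousOn.mul hu)
  exact (hc.integrable_of_hasCompactSupport hρc.mul_right).congr (Eventually.of_forall fun x ↦ by ring)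

variable (hG : IsMetricOn G V) (hG' : IsMetricOn G' V) (hρ : ContDiff ℝ 1 ρ) (hρc : HasCompactSupport ρ)
  (hρV : tsupport ρ ⊆ V)
include hG hG' hρ hρc hρV

/-- **Integration by parts of the principal term**:
`∫ ρ² (2 g^{ij} P) ∂ᵢ∂ⱼP = −∫ [2ρ∂ᵢρ (2 g^{ij} P) + ρ² 2 (∂ᵢg^{ij} P + g^{ij} ∂ᵢP)] ∂ⱼP`.
[cite: Kotschwar2014, §2.3] -/
theorem integral_principal_ibp (p : ι × ι) (i j : ι) :
    ∫ x, ρ x ^ 2 * (2 * (ginv G b x i j * pComp b G G' x p)) *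
        fderiv ℝ (fderiv ℝ (ricDiff G G')) x (b i) (b j) (b p.1) (b p.2) ∂μ =
      -∫ x, (2 * ρ x * fderiv ℝ ρ x (b i) * (2 * (ginv G b x i j * pComp b G G' x p))
        + ρ x ^ 2 * (2 * (dginv b G x (b i) i j * pComp b G G' x p
          + ginv G b x i j * dpComp b G G' x (i, p)))) * dpComp b G G' x (j, p) ∂μ := by
  have hV := hG.isOpen
  have hP : ContDiffOn ℝ ∞ (ricDiff G G') V := hG.contDiffOn_ricDiff hG'
  have hDP : ContDiffOn ℝ ∞ (fderiv ℝ (ricDiff G G')) V := hP.fderiv_of_isOpen hV (by simp)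
  -- `ψ = ∂ⱼP(b_k,b_l)`, `φ = 2 g^{ij} P_{kl}`
  set ψ : E → ℝ := fun y ↦ dpComp b G G' y (j, p) with hψ
  set φ : E → ℝ := fun y ↦ 2 * (ginv G b y i j * pComp b G G' y p) with hφ
  have hψs : ContDiffOn ℝ 1 ψ V :=
    ((((hDP.clm_apply contDiffOn_const).clm_apply contDiffOn_const).clm_apply contDiffOn_const).of_le
      (m := 1) (by simp) :)
  have hPc : ContDiffOn ℝ ∞ (fun y ↦ pComp b G G' y p) V :=
    (hP.clm_apply contDiffOn_const).clm_apply contDiffOn_const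
  have hφs : ContDiffOn ℝ 1 φ V :=
    ((contDiffOn_const.mul ((hG.contDiffOn_ginv b i j).mul hPc)).of_le (m := 1) (by simp) :)
  -- the derivative of `ψ` along `bᵢ` on `V`
  have hdψ : ∀ x ∈ V, fderiv ℝ ψ x (b i) = fderiv ℝ (fderiv ℝ (ricDiff G G')) x (b i) (b j) (b p.1) (b p.2) := by
    intro x hx
    have hd : DifferentiableAt ℝ (fderiv ℝ (ricDiff G G')) x :=
      ((hDP x hx).contDiffAt (hV.mem_nhds hx)).differentiableAt (by simp)
    rw [hψ]
    unfold dpComp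
    rw [fderiv_clm_apply_const (differentiableAt_clm_apply_const (differentiableAt_clm_apply_const hd (b j))
        (b p.1)) (b p.2) (b i),
      fderiv_clm_apply_const (differentiableAt_clm_apply_const hd (b j)) (b p.1) (b i),
      fderiv_clm_apply_const hd (b j) (b i)]
  -- the derivative of `φ` along `bᵢ` on `V`
  have hdφ : ∀ x ∈ V, fderiv ℝ φ x (b i) =
      2 * (dginv b G x (b i) i j * pComp b G G' x p + ginv G b x i j * dpComp b G G' x (i, p)) := by
    intro x hx
    have hg := hG.hasFDerivAt_ginv (b := b) hx i j
    have hPd : DifferentiableAt ℝ (ricDiff G G') x :=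
      ((hP x hx).contDiffAt (hV.mem_nhds hx)).differentiableAt (by simp)
    have hPp : HasFDerivAt (fun y ↦ pComp b G G' y p) (((fderiv ℝ (ricDiff G G') x).flip (b p.1)).flip (b p.2)) x :=
      hasFDerivAt_clm_apply_const (hasFDerivAt_clm_apply_const hPd.hasFDerivAt (b p.1)) (b p.2)
    have h := (hg.fun_mul hPp).const_mul (2 : ℝ)
    rw [hφ, h.fderiv]
    simp only [_root_.smul_apply, _root_.add_apply, ContinuousLinearMap.comp_apply,
      ContinuousLinearMap.flip_apply, smul_eq_mul, dginv, dpComp]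
    ring
  have key := integral_rhoSq_mul_fderiv (μ := μ) hV hρ hρc hρV hφs hψs (b i)
  have hρ0 : ∀ x ∉ V, ρ x = 0 := fun x hx ↦ image_eq_zero_of_notMem_tsupport fun h ↦ hx (hρV h)
  -- rewrite both sides pointwise
  have hl : (fun x ↦ ρ x ^ 2 * (2 * (ginv G b x i j * pComp b G G' x p)) *
      fderiv ℝ (fderiv ℝ (ricDiff G G')) x (b i) (b j) (b p.1) (b p.2)) =
      fun x ↦ ρ x ^ 2 * φ x * fderiv ℝ ψ x (b i) := by
    funext x
    by_cases hx : x ∈ V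
    · rw [hdψ x hx]
    · rw [hρ0 x hx]; ring
  have hr : (fun x ↦ (2 * ρ x * fderiv ℝ ρ x (b i) * (2 * (ginv G b x i j * pComp b G G' x p))
        + ρ x ^ 2 * (2 * (dginv b G x (b i) i j * pComp b G G' x p
          + ginv G b x i j * dpComp b G G' x (i, p)))) * dpComp b G G' x (j, p)) =
      fun x ↦ (2 * ρ x * fderiv ℝ ρ x (b i) * φ x + ρ x ^ 2 * fderiv ℝ φ x (b i)) * ψ x := by
    funext x
    by_cases hx : x ∈ V
    · rw [hdφ x hx]
    · rw [hρ0 x hx]; ring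
  rw [hl, hr, key]

omit [Fintype ι] in
/-- **Integration by parts of a divergence term**: for `ψ` of class `C¹` on `V` and a direction `d`,
`∫ ρ² (2P_{kl}) ∂_d ψ = −∫ [2ρ ∂_dρ (2P_{kl}) + ρ² (2 ∂_dP_{kl})] ψ`. [cite: Kotschwar2014, §2.3] -/
theorem integral_div_ibp (p : ι × ι) {ψ : E → ℝ} (hψ : ContDiffOn ℝ 1 ψ V) (m : ι) :
    ∫ x, ρ x ^ 2 * (2 * pComp b G G' x p) * fderiv ℝ ψ x (b m) ∂μ =
      -∫ x, (2 * ρ x * fderiv ℝ ρ x (b m) * (2 * pComp b G G' x p)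
        + ρ x ^ 2 * (2 * dpComp b G G' x (m, p))) * ψ x ∂μ := by
  have hV := hG.isOpen
  have hP : ContDiffOn ℝ ∞ (ricDiff G G') V := hG.contDiffOn_ricDiff hG'
  set φ : E → ℝ := fun y ↦ 2 * pComp b G G' y p with hφ
  have hφs : ContDiffOn ℝ 1 φ V :=
    ((contDiffOn_const.mul ((hP.clm_apply contDiffOn_const).clm_apply contDiffOn_const)).of_le
      (m := 1) (by simp) :)
  have hdφ : ∀ x ∈ V, fderiv ℝ φ x (b m) = 2 * dpComp b G G' x (m, p) := by
    intro x hx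
    have hPd : DifferentiableAt ℝ (ricDiff G G') x :=
      ((hP x hx).contDiffAt (hV.mem_nhds hx)).differentiableAt (by simp)
    have hPp : HasFDerivAt (fun y ↦ pComp b G G' y p) (((fderiv ℝ (ricDiff G G') x).flip (b p.1)).flip (b p.2)) x :=
      hasFDerivAt_clm_apply_const (hasFDerivAt_clm_apply_const hPd.hasFDerivAt (b p.1)) (b p.2)
    rw [hφ, (hPp.const_mul (2 : ℝ)).fderiv]
    simp only [_root_.smul_apply, ContinuousLinearMap.flip_apply, smul_eq_mul, dpComp]
  have key := integral_rhoSq_mul_fderiv (μ := μ) hV hρ hρc hρV hφs hψ (b m)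
  have hρ0 : ∀ x ∉ V, ρ x = 0 := fun x hx ↦ image_eq_zero_of_notMem_tsupport fun h ↦ hx (hρV h)
  have hr : (fun x ↦ (2 * ρ x * fderiv ℝ ρ x (b m) * (2 * pComp b G G' x p)
        + ρ x ^ 2 * (2 * dpComp b G G' x (m, p))) * ψ x) =
      fun x ↦ (2 * ρ x * fderiv ℝ ρ x (b m) * φ x + ρ x ^ 2 * fderiv ℝ φ x (b m)) * ψ x := by
    funext x
    by_cases hx : x ∈ V
    · rw [hdφ x hx]
    · rw [hρ0 x hx]; ring
  rw [hr, ← key]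

/-- **The energy integral after integration by parts**:
`∫ ρ² eDeriv = ∫ phi0 + ∫ phiPr + ∫ phiDv`. [cite: Kotschwar2014, §2.3] -/
theorem integral_rhoSq_eDeriv_eq :
    ∫ x, ρ x ^ 2 * eDeriv b G G' x ∂μ =
      (∫ x, phi0 b G G' ρ x ∂μ) + (∫ x, phiPr b G G' ρ x ∂μ) + ∫ x, phiDv b G G' ρ x ∂μ := by
  have hV := hG.isOpen
  -- the pointwise splitting `ρ² eDeriv = phi0 + prA + dvB`
  set prA : E → ℝ := fun x ↦ ∑ p, ∑ i, ∑ j, ρ x ^ 2 * (2 * (ginv G b x i j * pComp b G G' x p)) *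
    fderiv ℝ (fderiv ℝ (ricDiff G G')) x (b i) (b j) (b p.1) (b p.2) with hprA
  set dvB : E → ℝ := fun x ↦ ∑ p, ((∑ i, ρ x ^ 2 * (2 * pComp b G G' x p) *
      fderiv ℝ (uPot b G G' (b p.1) (b p.2) i) x (b i))
    + ρ x ^ 2 * (2 * pComp b G G' x p) * fderiv ℝ (vPot b G G' (b p.2)) x (b p.1)
    + ρ x ^ 2 * (2 * pComp b G G' x p) * fderiv ℝ (vPot b G G' (b p.1)) x (b p.2)) with hdvB
  have hpt : ∀ x, ρ x ^ 2 * eDeriv b G G' x = phi0 b G G' ρ x + prA x + dvB x := by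
    intro x
    have key : ∀ p : ι × ι, ρ x ^ 2 * (2 * pComp b G G' x p *
        (ricEvolAt b G x (b p.1) (b p.2) - ricEvolAt b G' x (b p.1) (b p.2))) =
        ρ x ^ 2 * (2 * pComp b G G' x p * resComp b G G' x p)
        + (∑ i, ∑ j, ρ x ^ 2 * (2 * (ginv G b x i j * pComp b G G' x p)) *
            fderiv ℝ (fderiv ℝ (ricDiff G G')) x (b i) (b j) (b p.1) (b p.2))
        + ((∑ i, ρ x ^ 2 * (2 * pComp b G G' x p) * fderiv ℝ (uPot b G G' (b p.1) (b p.2) i) x (b i))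
          + ρ x ^ 2 * (2 * pComp b G G' x p) * fderiv ℝ (vPot b G G' (b p.2)) x (b p.1)
          + ρ x ^ 2 * (2 * pComp b G G' x p) * fderiv ℝ (vPot b G G' (b p.1)) x (b p.2)) := by
      intro p
      have A1 : (∑ i, ∑ j, ρ x ^ 2 * (2 * (ginv G b x i j * pComp b G G' x p)) *
          fderiv ℝ (fderiv ℝ (ricDiff G G')) x (b i) (b j) (b p.1) (b p.2)) =
          ρ x ^ 2 * (2 * pComp b G G' x p) * ∑ i, ∑ j, ginv G b x i j *
            fderiv ℝ (fderiv ℝ (ricDiff G G')) x (b i) (b j) (b p.1) (b p.2) := by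
        rw [Finset.mul_sum]
        refine Finset.sum_congr rfl fun i _ ↦ ?_
        rw [Finset.mul_sum]
        exact Finset.sum_congr rfl fun j _ ↦ by ring
      have A2 : (∑ i, ρ x ^ 2 * (2 * pComp b G G' x p) * fderiv ℝ (uPot b G G' (b p.1) (b p.2) i) x (b i)) =
          ρ x ^ 2 * (2 * pComp b G G' x p) * ∑ i, fderiv ℝ (uPot b G G' (b p.1) (b p.2) i) x (b i) := by
        rw [Finset.mul_sum]
      rw [A1, A2, resComp]
      ring
    have hC : (∑ p, ρ x ^ 2 * (2 * pComp b G G' x p *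
        (ricEvolAt b G x (b p.1) (b p.2) - ricEvolAt b G' x (b p.1) (b p.2)))) =
        (∑ p, ρ x ^ 2 * (2 * pComp b G G' x p * resComp b G G' x p)) + prA x + dvB x := by
      simp only [hprA, hdvB]
      rw [← Finset.sum_add_distrib, ← Finset.sum_add_distrib]
      exact Finset.sum_congr rfl fun p _ ↦ key p
    have e1 : ρ x ^ 2 * eDeriv b G G' x =
        ρ x ^ 2 * (∑ p, 2 * hComp b G G' x p * (-2 * pComp b G G' x p)
          + ∑ t, 2 * aComp b G G' x t * piComp b G G' x t)
        + ∑ p, ρ x ^ 2 * (2 * pComp b G G' x p *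
          (ricEvolAt b G x (b p.1) (b p.2) - ricEvolAt b G' x (b p.1) (b p.2))) := by
      rw [eDeriv, mul_add, Finset.mul_sum]
    have e2 : phi0 b G G' ρ x =
        ρ x ^ 2 * (∑ p, 2 * hComp b G G' x p * (-2 * pComp b G G' x p)
          + ∑ t, 2 * aComp b G G' x t * piComp b G G' x t)
        + ∑ p, ρ x ^ 2 * (2 * pComp b G G' x p * resComp b G G' x p) := by
      rw [phi0, mul_add, Finset.mul_sum]
    rw [e1, e2, hC]
    ring
  /- integrability of all the pieces -/
  have hρ2 := fun {u : E → ℝ} (hu : ContinuousOn u V) ↦ integrable_rhoSq_mul (μ := μ) hV hρ hρc hρV hu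
  have hρ1 := fun {u : E → ℝ} (hu : ContinuousOn u V) (v : E) ↦
    integrable_rho_drho_mul (μ := μ) hV hρ hρc hρV hu v
  have hP := fun p ↦ hG.continuousOn_pComp (b := b) hG' p
  have hdP := fun t ↦ hG.continuousOn_dpComp (b := b) hG' t
  have hg := fun i j ↦ hG.continuousOn_ginv (b := b) i j
  have hdg := fun W i j ↦ hG.continuousOn_dginv (b := b) W i j
  have hdd := fun i j k l ↦ hG.continuousOn_ddP (b := b) hG' i j k l
  have hu : ∀ (p : ι × ι) i, ContinuousOn (uPot b G G' (b p.1) (b p.2) i) V := fun p i ↦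
    (hG.contDiffOn_uPot hG' _ _ i).continuousOn
  have hdu : ∀ (p : ι × ι) i, ContinuousOn (fun y ↦ fderiv ℝ (uPot b G G' (b p.1) (b p.2) i) y (b i)) V :=
    fun p i ↦ ((hG.contDiffOn_uPot hG' _ _ i).continuousOn_fderiv_of_isOpen hV (by simp)).clm_apply
      continuousOn_const
  have hv : ∀ W : E, ContinuousOn (vPot b G G' W) V := fun W ↦ (hG.contDiffOn_vPot hG' W).continuousOn
  have hdv : ∀ (W d : E), ContinuousOn (fun y ↦ fderiv ℝ (vPot b G G' W) y d) V := fun W d ↦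
    ((hG.contDiffOn_vPot hG' W).continuousOn_fderiv_of_isOpen hV (by simp)).clm_apply continuousOn_const
  -- `phi0`
  have hint0 : Integrable (phi0 b G G' ρ) μ := by
    refine hρ2 (u := fun x ↦ ∑ p, 2 * hComp b G G' x p * (-2 * pComp b G G' x p)
      + ∑ t, 2 * aComp b G G' x t * piComp b G G' x t
      + ∑ p, 2 * pComp b G G' x p * resComp b G G' x p) ?_
    refine ((continuousOn_finsetSum _ fun p _ ↦ ?_).add (continuousOn_finsetSum _ fun t _ ↦ ?_)).add
      (continuousOn_finsetSum _ fun p _ ↦ ?_)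
    · exact (continuousOn_const.mul (hG.continuousOn_hComp hG' p)).mul (continuousOn_const.mul (hP p))
    · exact (continuousOn_const.mul (hG.continuousOn_aComp hG' t)).mul (hG.continuousOn_piComp hG' t)
    · exact (continuousOn_const.mul (hP p)).mul (hG.continuousOn_resComp hG' p)
  -- principal terms, before and after integration by parts
  have hintA : ∀ (p : ι × ι) i j, Integrable (fun x ↦ ρ x ^ 2 * (2 * (ginv G b x i j * pComp b G G' x p)) *
      fderiv ℝ (fderiv ℝ (ricDiff G G')) x (b i) (b j) (b p.1) (b p.2)) μ := by
    intro p i j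
    have h := hρ2 (u := fun x ↦ 2 * (ginv G b x i j * pComp b G G' x p) *
      fderiv ℝ (fderiv ℝ (ricDiff G G')) x (b i) (b j) (b p.1) (b p.2))
      ((continuousOn_const.mul ((hg i j).mul (hP p))).mul (hdd i j p.1 p.2))
    exact h.congr (Eventually.of_forall fun x ↦ by ring)
  have hintA' : ∀ (p : ι × ι) i j, Integrable (fun x ↦
      (2 * ρ x * fderiv ℝ ρ x (b i) * (2 * (ginv G b x i j * pComp b G G' x p))
        + ρ x ^ 2 * (2 * (dginv b G x (b i) i j * pComp b G G' x p
          + ginv G b x i j * dpComp b G G' x (i, p)))) * dpComp b G G' x (j, p)) μ := by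
    intro p i j
    have h1 := hρ1 (u := fun x ↦ 2 * (ginv G b x i j * pComp b G G' x p) * dpComp b G G' x (j, p))
      ((continuousOn_const.mul ((hg i j).mul (hP p))).mul (hdP (j, p))) (b i)
    have h2 := hρ2 (u := fun x ↦ 2 * (dginv b G x (b i) i j * pComp b G G' x p
        + ginv G b x i j * dpComp b G G' x (i, p)) * dpComp b G G' x (j, p))
      ((continuousOn_const.mul (((hdg (b i) i j).mul (hP p)).add ((hg i j).mul (hdP (i, p))))).mul
        (hdP (j, p)))
    exact ((h1.const_mul 2).add h2).congr (Eventually.of_forall fun x ↦ by simp only [Pi.add_apply]; ring)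
  -- divergence terms, before and after integration by parts
  have hintU : ∀ (p : ι × ι) i, Integrable (fun x ↦ ρ x ^ 2 * (2 * pComp b G G' x p) *
      fderiv ℝ (uPot b G G' (b p.1) (b p.2) i) x (b i)) μ := by
    intro p i
    have h := hρ2 (u := fun x ↦ 2 * pComp b G G' x p * fderiv ℝ (uPot b G G' (b p.1) (b p.2) i) x (b i))
      ((continuousOn_const.mul (hP p)).mul (hdu p i))
    exact h.congr (Eventually.of_forall fun x ↦ by ring)
  have hintV : ∀ (p : ι × ι) (W d : E), Integrable (fun x ↦ ρ x ^ 2 * (2 * pComp b G G' x p) *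
      fderiv ℝ (vPot b G G' W) x d) μ := by
    intro p W d
    have h := hρ2 (u := fun x ↦ 2 * pComp b G G' x p * fderiv ℝ (vPot b G G' W) x d)
      ((continuousOn_const.mul (hP p)).mul (hdv W d))
    exact h.congr (Eventually.of_forall fun x ↦ by ring)
  have hintW' : ∀ (p : ι × ι) (m : ι) {w : E → ℝ}, ContinuousOn w V → Integrable (fun x ↦
      (2 * ρ x * fderiv ℝ ρ x (b m) * (2 * pComp b G G' x p) + ρ x ^ 2 * (2 * dpComp b G G' x (m, p))) * w x) μ := by
    intro p m w hw
    have h1 := hρ1 (u := fun x ↦ 2 * pComp b G G' x p * w x) ((continuousOn_const.mul (hP p)).mul hw) (b m)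
    have h2 := hρ2 (u := fun x ↦ 2 * dpComp b G G' x (m, p) * w x) ((continuousOn_const.mul (hdP (m, p))).mul hw)
    exact ((h1.const_mul 2).add h2).congr (Eventually.of_forall fun x ↦ by simp only [Pi.add_apply]; ring)
  -- splitting a threefold sum of integrable functions
  have split3 : ∀ {f g h : E → ℝ}, Integrable f μ → Integrable g μ → Integrable h μ →
      ∫ x, (f x + g x + h x) ∂μ = (∫ x, f x ∂μ) + (∫ x, g x ∂μ) + ∫ x, h x ∂μ := by
    intro f g h hf hg hh
    have e1 : ∫ x, (f x + g x + h x) ∂μ = ∫ x, ((f + g) x + h x) ∂μ := rfl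
    rw [e1, integral_add (hf.add hg) hh]
    congr 1
    exact integral_add hf hg
  /- the principal part -/
  have hA : ∫ x, prA x ∂μ = ∫ x, phiPr b G G' ρ x ∂μ := by
    have h1 : ∫ x, prA x ∂μ = ∑ p, ∑ i, ∑ j, ∫ x, ρ x ^ 2 * (2 * (ginv G b x i j * pComp b G G' x p)) *
        fderiv ℝ (fderiv ℝ (ricDiff G G')) x (b i) (b j) (b p.1) (b p.2) ∂μ := by
      rw [hprA, integral_finsetSum _ fun p _ ↦ integrable_finsetSum _ fun i _ ↦
        integrable_finsetSum _ fun j _ ↦ hintA p i j]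
      refine Finset.sum_congr rfl fun p _ ↦ ?_
      rw [integral_finsetSum _ fun i _ ↦ integrable_finsetSum _ fun j _ ↦ hintA p i j]
      refine Finset.sum_congr rfl fun i _ ↦ ?_
      rw [integral_finsetSum _ fun j _ ↦ hintA p i j]
    have h2 : ∫ x, phiPr b G G' ρ x ∂μ = -∑ p, ∑ i, ∑ j, ∫ x,
        (2 * ρ x * fderiv ℝ ρ x (b i) * (2 * (ginv G b x i j * pComp b G G' x p))
          + ρ x ^ 2 * (2 * (dginv b G x (b i) i j * pComp b G G' x p
            + ginv G b x i j * dpComp b G G' x (i, p)))) * dpComp b G G' x (j, p) ∂μ := by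
      unfold phiPr
      rw [integral_neg, integral_finsetSum _ fun p _ ↦ integrable_finsetSum _ fun i _ ↦
        integrable_finsetSum _ fun j _ ↦ hintA' p i j]
      congr 1
      refine Finset.sum_congr rfl fun p _ ↦ ?_
      rw [integral_finsetSum _ fun i _ ↦ integrable_finsetSum _ fun j _ ↦ hintA' p i j]
      refine Finset.sum_congr rfl fun i _ ↦ ?_
      rw [integral_finsetSum _ fun j _ ↦ hintA' p i j]
    rw [h1, h2, ← Finset.sum_neg_distrib]
    refine Finset.sum_congr rfl fun p _ ↦ ?_
    rw [← Finset.sum_neg_distrib]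
    refine Finset.sum_congr rfl fun i _ ↦ ?_
    rw [← Finset.sum_neg_distrib]
    refine Finset.sum_congr rfl fun j _ ↦ ?_
    exact integral_principal_ibp hG hG' hρ hρc hρV p i j
  /- the divergence part -/
  have hB : ∫ x, dvB x ∂μ = ∫ x, phiDv b G G' ρ x ∂μ := by
    have hU1 : ∀ p : ι × ι, ContDiffOn ℝ 1 (vPot b G G' (b p.2)) V := fun p ↦
      (hG.contDiffOn_vPot hG' _).of_le (m := 1) (by simp)
    have hU2 : ∀ p : ι × ι, ContDiffOn ℝ 1 (vPot b G G' (b p.1)) V := fun p ↦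
      (hG.contDiffOn_vPot hG' _).of_le (m := 1) (by simp)
    have hU3 : ∀ (p : ι × ι) i, ContDiffOn ℝ 1 (uPot b G G' (b p.1) (b p.2) i) V := fun p i ↦
      (hG.contDiffOn_uPot hG' _ _ i).of_le (m := 1) (by simp)
    have h1 : ∫ x, dvB x ∂μ = ∑ p, ((∑ i, ∫ x, ρ x ^ 2 * (2 * pComp b G G' x p) *
          fderiv ℝ (uPot b G G' (b p.1) (b p.2) i) x (b i) ∂μ)
        + (∫ x, ρ x ^ 2 * (2 * pComp b G G' x p) * fderiv ℝ (vPot b G G' (b p.2)) x (b p.1) ∂μ)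
        + ∫ x, ρ x ^ 2 * (2 * pComp b G G' x p) * fderiv ℝ (vPot b G G' (b p.1)) x (b p.2) ∂μ) := by
      have hintp : ∀ p : ι × ι, Integrable (fun x ↦ (∑ i, ρ x ^ 2 * (2 * pComp b G G' x p) *
            fderiv ℝ (uPot b G G' (b p.1) (b p.2) i) x (b i))
          + ρ x ^ 2 * (2 * pComp b G G' x p) * fderiv ℝ (vPot b G G' (b p.2)) x (b p.1)
          + ρ x ^ 2 * (2 * pComp b G G' x p) * fderiv ℝ (vPot b G G' (b p.1)) x (b p.2)) μ := fun p ↦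
        ((integrable_finsetSum _ fun i _ ↦ hintU p i).add (hintV p _ _)).add (hintV p _ _)
      rw [hdvB, integral_finsetSum _ fun p _ ↦ hintp p]
      refine Finset.sum_congr rfl fun p _ ↦ ?_
      refine (split3 (integrable_finsetSum _ fun i _ ↦ hintU p i) (hintV p _ _) (hintV p _ _)).trans ?_
      rw [integral_finsetSum _ fun i _ ↦ hintU p i]
    have h2 : ∫ x, phiDv b G G' ρ x ∂μ = -∑ p, ((∑ i, ∫ x,
          (2 * ρ x * fderiv ℝ ρ x (b i) * (2 * pComp b G G' x p)
            + ρ x ^ 2 * (2 * dpComp b G G' x (i, p))) * uPot b G G' (b p.1) (b p.2) i x ∂μ)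
        + (∫ x, (2 * ρ x * fderiv ℝ ρ x (b p.1) * (2 * pComp b G G' x p)
            + ρ x ^ 2 * (2 * dpComp b G G' x (p.1, p))) * vPot b G G' (b p.2) x ∂μ)
        + ∫ x, (2 * ρ x * fderiv ℝ ρ x (b p.2) * (2 * pComp b G G' x p)
            + ρ x ^ 2 * (2 * dpComp b G G' x (p.2, p))) * vPot b G G' (b p.1) x ∂μ) := by
      have hintp : ∀ p : ι × ι, Integrable (fun x ↦ (∑ i,
            (2 * ρ x * fderiv ℝ ρ x (b i) * (2 * pComp b G G' x p)
              + ρ x ^ 2 * (2 * dpComp b G G' x (i, p))) * uPot b G G' (b p.1) (b p.2) i x)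
          + (2 * ρ x * fderiv ℝ ρ x (b p.1) * (2 * pComp b G G' x p)
              + ρ x ^ 2 * (2 * dpComp b G G' x (p.1, p))) * vPot b G G' (b p.2) x
          + (2 * ρ x * fderiv ℝ ρ x (b p.2) * (2 * pComp b G G' x p)
              + ρ x ^ 2 * (2 * dpComp b G G' x (p.2, p))) * vPot b G G' (b p.1) x) μ := fun p ↦
        ((integrable_finsetSum _ fun i _ ↦ hintW' p i (hu p i)).add (hintW' p p.1 (hv _))).add
          (hintW' p p.2 (hv _))
      unfold phiDv
      rw [integral_neg, integral_finsetSum _ fun p _ ↦ hintp p]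
      congr 1
      refine Finset.sum_congr rfl fun p _ ↦ ?_
      refine (split3 (integrable_finsetSum _ fun i _ ↦ hintW' p i (hu p i)) (hintW' p p.1 (hv _))
        (hintW' p p.2 (hv _))).trans ?_
      rw [integral_finsetSum _ fun i _ ↦ hintW' p i (hu p i)]
    rw [h1, h2, ← Finset.sum_neg_distrib]
    refine Finset.sum_congr rfl fun p _ ↦ ?_
    rw [neg_add, neg_add, ← Finset.sum_neg_distrib]
    congr 1
    · congr 1
      · exact Finset.sum_congr rfl fun i _ ↦ integral_div_ibp hG hG' hρ hρc hρV p (hU3 p i) i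
      · exact integral_div_ibp hG hG' hρ hρc hρV p (hU1 p) p.1
    · exact integral_div_ibp hG hG' hρ hρc hρV p (hU2 p) p.2
  -- assemble
  have hintPr : Integrable prA μ := by
    rw [hprA]
    exact integrable_finsetSum _ fun p _ ↦ integrable_finsetSum _ fun i _ ↦
      integrable_finsetSum _ fun j _ ↦ hintA p i j
  have hintDv : Integrable dvB μ := by
    rw [hdvB]
    exact integrable_finsetSum _ fun p _ ↦
      ((integrable_finsetSum _ fun i _ ↦ hintU p i).add (hintV p _ _)).add (hintV p _ _)
  calc ∫ x, ρ x ^ 2 * eDeriv b G G' x ∂μ = ∫ x, (phi0 b G G' ρ x + prA x + dvB x) ∂μ :=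
        integral_congr_ae (Eventually.of_forall hpt)
    _ = (∫ x, phi0 b G G' ρ x ∂μ) + (∫ x, prA x ∂μ) + ∫ x, dvB x ∂μ := split3 hint0 hintPr hintDv
    _ = _ := by rw [hA, hB]

end Integrals

/-! ### The pointwise estimate of the integrand after integration by parts -/

section Pointwise

variable {ι : Type*} [Fintype ι] [FiniteDimensional ℝ E] [CompleteSpace E] {b : Basis ι ℝ E}
  {G G' : E → E →L[ℝ] E →L[ℝ] ℝ} {V : Set E} {x : E} {N : ℝ}

omit [FiniteDimensional ℝ E] [CompleteSpace E] in
/-- `|Σ f| ≤ card · B` if `|f a| ≤ B` for all `a`. [folklore] -/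
theorem abs_sum_le_card_mul {α : Type*} [Fintype α] (f : α → ℝ) {B : ℝ} (h : ∀ a, |f a| ≤ B) :
    |∑ a, f a| ≤ Fintype.card α * B :=
  calc |∑ a, f a| ≤ ∑ a, |f a| := Finset.abs_sum_le_sum_abs _ _
    _ ≤ ∑ _a : α, B := Finset.sum_le_sum fun a _ ↦ h a
    _ = Fintype.card α * B := by simp [Finset.sum_const, Finset.card_univ]

omit [FiniteDimensional ℝ E] [CompleteSpace E] in
/-- A single term is bounded by the `ℓ¹`-sum. [folklore] -/
theorem abs_le_sum_abs {α : Type*} [Fintype α] (f : α → ℝ) (a : α) : |f a| ≤ ∑ a', |f a'| :=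
  Finset.single_le_sum (f := fun a' ↦ |f a'|) (fun _ _ ↦ abs_nonneg _) (Finset.mem_univ a)

omit [FiniteDimensional ℝ E] [CompleteSpace E] in
/-- `(Σ |f|)² ≤ card · Σ f²`. [folklore] -/
theorem sq_sum_abs_le {α : Type*} [Fintype α] (f : α → ℝ) :
    (∑ a, |f a|) ^ 2 ≤ Fintype.card α * ∑ a, f a ^ 2 := by
  have h := sq_sum_le_card_mul_sum_sq (s := Finset.univ) (f := fun a ↦ |f a|)
  simp only [Finset.card_univ, sq_abs] at h
  exact h

/-- The constant of the energy inequality, a polynomial in the dimension `n`, the background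
bound `N`, the ellipticity constant `λ⁻¹` and the bounds `R₀ ≥ |ρ|`, `R₁ ≥ ‖Dρ‖`.
[cite: Kotschwar2014, Prop. 7] -/
def energyConst (n : ℕ) (N lam R₀ R₁ : ℝ) : ℝ :=
  3 * (n : ℝ) ^ 3 * (((n : ℝ) ^ 4 * N ^ 14) * (250 * R₀ ^ 2 + 40 * R₀ * R₁)
    + (((n : ℝ) ^ 4 * N ^ 14) * (272 * R₀ + 4 * R₁) + 1)
      * ((((n : ℝ) ^ 4 * N ^ 14) * (272 * R₀ + 4 * R₁) + 1) * (n : ℝ) ^ 3 + 1) / (4 * lam))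

/-- The energy constant is nonnegative. [folklore] -/
theorem energyConst_nonneg (n : ℕ) {N lam R₀ R₁ : ℝ} (hlam : 0 < lam) (hR₀ : 0 ≤ R₀)
    (hR₁ : 0 ≤ R₁) : 0 ≤ energyConst n N lam R₀ R₁ := by
  unfold energyConst
  positivity

variable (hN : PairBound b G G' x N)
include hN

omit [Fintype ι] [CompleteSpace E] in
/-- `|∂_{bᵢ} ρ| ≤ R₁ N`. [folklore] -/
theorem PairBound.abs_fderiv_rho_le {ρ : E → ℝ} {R₁ : ℝ} (hdρ : ‖fderiv ℝ ρ x‖ ≤ R₁) (i : ι) :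
    |fderiv ℝ ρ x (b i)| ≤ R₁ * N := by
  rw [← Real.norm_eq_abs]
  exact (le_opNorm _ _).trans (mul_le_mul hdρ (hN.basis i) (norm_nonneg _) ((norm_nonneg _).trans hdρ))

omit [CompleteSpace E] in
/-- **The operator norms of `H, A, P, DP` are bounded by the `ℓ¹` sums of the components**:
`‖H‖ + ‖A‖ + ‖P‖ + ‖DP‖ ≤ N³ (X + Q)`. [folklore] -/
theorem PairBound.norm_sum_le :
    ‖G x - G' x‖ + ‖chrDiff G G' x‖ + ‖ricDiff G G' x‖ + ‖fderiv ℝ (ricDiff G G') x‖ ≤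
      N ^ 3 * ((∑ p, |hComp b G G' x p| + ∑ t, |aComp b G G' x t| + ∑ p, |pComp b G G' x p|)
        + ∑ t, |dpComp b G G' x t|) := by
  have h0 := hN.nonneg
  have h1 := hN.one_le
  have hN23 : N ^ 2 ≤ N ^ 3 := hN.pow_le_pow (by norm_num)
  have hH : ‖G x - G' x‖ ≤ N ^ 3 * ∑ p, |hComp b G G' x p| := by
    calc ‖G x - G' x‖ ≤ N ^ 2 * ∑ k, ∑ l, |(G x - G' x) (b k) (b l)| :=
          norm_le_sum_abs_apply₂ b h0 hN.coord _
      _ = N ^ 2 * ∑ p, |hComp b G G' x p| := by rw [Fintype.sum_prod_type]; rfl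
      _ ≤ N ^ 3 * ∑ p, |hComp b G G' x p| := by gcongr
  have hA : ‖chrDiff G G' x‖ ≤ N ^ 3 * ∑ t, |aComp b G G' x t| := by
    calc ‖chrDiff G G' x‖ ≤ N ^ 3 * ∑ k, ∑ l, ∑ m, |coordCLM b m (chrDiff G G' x (b k) (b l))| :=
          norm_le_sum_abs_coord_apply₂ b h0 hN.coord hN.basis _
      _ = N ^ 3 * ∑ t, |aComp b G G' x t| := by
          rw [Fintype.sum_prod_type]
          simp only [Fintype.sum_prod_type, aComp]
  have hP : ‖ricDiff G G' x‖ ≤ N ^ 3 * ∑ p, |pComp b G G' x p| := by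
    calc ‖ricDiff G G' x‖ ≤ N ^ 2 * ∑ k, ∑ l, |ricDiff G G' x (b k) (b l)| :=
          norm_le_sum_abs_apply₂ b h0 hN.coord _
      _ = N ^ 2 * ∑ p, |pComp b G G' x p| := by rw [Fintype.sum_prod_type]; rfl
      _ ≤ N ^ 3 * ∑ p, |pComp b G G' x p| := by gcongr
  have hdP : ‖fderiv ℝ (ricDiff G G') x‖ ≤ N ^ 3 * ∑ t, |dpComp b G G' x t| := by
    calc ‖fderiv ℝ (ricDiff G G') x‖ ≤ N ^ 3 * ∑ j, ∑ k, ∑ l, |fderiv ℝ (ricDiff G G') x (b j) (b k) (b l)| :=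
          norm_le_sum_abs_apply₃ b h0 hN.coord _
      _ = N ^ 3 * ∑ t, |dpComp b G G' x t| := by
          rw [Fintype.sum_prod_type]
          simp only [Fintype.sum_prod_type, dpComp]
  linarith

omit [CompleteSpace E] in
/-- `‖A‖ ≤ N³ Σ_t |A_t|`. [folklore] -/
theorem PairBound.norm_chrDiff_le : ‖chrDiff G G' x‖ ≤ N ^ 3 * ∑ t, |aComp b G G' x t| := by
  calc ‖chrDiff G G' x‖ ≤ N ^ 3 * ∑ k, ∑ l, ∑ m, |coordCLM b m (chrDiff G G' x (b k) (b l))| :=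
        norm_le_sum_abs_coord_apply₂ b hN.nonneg hN.coord hN.basis _
    _ = N ^ 3 * ∑ t, |aComp b G G' x t| := by
        rw [Fintype.sum_prod_type]
        simp only [Fintype.sum_prod_type, aComp]

/-- `|piComp t| ≤ 27 N¹¹ (X + Q)`. [cite: Kotschwar2014, §1.1 (9)] -/
theorem PairBound.abs_piComp_le (hG : IsMetricOn G V) (hG' : IsMetricOn G' V) (hx : x ∈ V)
    (t : ι × ι × ι) :
    |piComp b G G' x t| ≤ 27 * N ^ 11 *
      ((∑ p, |hComp b G G' x p| + ∑ t, |aComp b G G' x t| + ∑ p, |pComp b G G' x p|)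
        + ∑ t, |dpComp b G G' x t|) := by
  have h0 := hN.nonneg
  have h1 := hN.one_le
  set X := ∑ p, |hComp b G G' x p| + ∑ t, |aComp b G G' x t| + ∑ p, |pComp b G G' x p|
  set Q := ∑ t, |dpComp b G G' x t|
  set D := ‖G x - G' x‖ + ‖chrDiff G G' x‖ + ‖ricDiff G G' x‖ + ‖fderiv ℝ (ricDiff G G') x‖ with hD
  have hD0 : 0 ≤ D := by positivity
  have hXQ : 0 ≤ X + Q := by positivity
  have hDle : D ≤ N ^ 3 * (X + Q) := hN.norm_sum_le
  have hPi := hN.norm_piFlowAt_sub_le b (hG.isInvertible x hx) (hG'.isInvertible x hx) (b t.1) (b t.2.1)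
  rw [← hG.fderiv_ricDiff hG' hx] at hPi
  have hPi' : ‖(piFlowAt G x - piFlowAt G' x) (b t.1) (b t.2.1)‖ ≤ 27 * N ^ 5 * D * N * N := by
    rw [_root_.sub_apply, _root_.sub_apply]
    have hD' : (‖G x - G' x‖ + ‖chrAt G x - chrAt G' x‖ + ‖ricAt G x - ricAt G' x‖
        + ‖fderiv ℝ (ricDiff G G') x‖) = D := by rw [hD]; rfl
    rw [hD'] at hPi
    calc _ ≤ 27 * N ^ 5 * D * ‖b t.1‖ * ‖b t.2.1‖ := hPi
      _ ≤ 27 * N ^ 5 * D * N * N := by gcongr; exacts [hN.basis _, hN.basis _]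
  rw [piComp, ← Real.norm_eq_abs]
  calc ‖coordCLM b t.2.2 ((piFlowAt G x - piFlowAt G' x) (b t.1) (b t.2.1))‖
      ≤ N * (27 * N ^ 5 * D * N * N) :=
        (le_opNorm _ _).trans (mul_le_mul (hN.coord _) hPi' (norm_nonneg _) h0)
    _ = 27 * N ^ 8 * D := by ring
    _ ≤ 27 * N ^ 8 * (N ^ 3 * (X + Q)) := by gcongr
    _ = 27 * N ^ 11 * (X + Q) := by ring

/-- `|resComp p| ≤ 96 n² N¹⁴ (X + Q)` on `V`. [cite: Kotschwar2014, §1.1 (10)] -/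
theorem PairBound.abs_resComp_le (hG : IsMetricOn G V) (hG' : IsMetricOn G' V) (hx : x ∈ V) (p : ι × ι) :
    |resComp b G G' x p| ≤ 96 * (Fintype.card ι : ℝ) ^ 2 * N ^ 14 *
      ((∑ p, |hComp b G G' x p| + ∑ t, |aComp b G G' x t| + ∑ p, |pComp b G G' x p|)
        + ∑ t, |dpComp b G G' x t|) := by
  have h0 := hN.nonneg
  have h1 := hN.one_le
  set n : ℝ := (Fintype.card ι : ℝ)
  set X := ∑ p, |hComp b G G' x p| + ∑ t, |aComp b G G' x t| + ∑ p, |pComp b G G' x p|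
  set Q := ∑ t, |dpComp b G G' x t|
  have hX0 : 0 ≤ X := by positivity
  have hQ0 : 0 ≤ Q := by positivity
  have hDle := hN.norm_sum_le
  have hA : ‖chrDiff G G' x‖ ≤ N ^ 3 * (X + Q) := by
    have := hN.norm_chrDiff_le
    have hsH : 0 ≤ ∑ p, |hComp b G G' x p| := Finset.sum_nonneg fun p _ ↦ abs_nonneg _
    have hsP : 0 ≤ ∑ p, |pComp b G G' x p| := Finset.sum_nonneg fun p _ ↦ abs_nonneg _
    have hle : ∑ t, |aComp b G G' x t| ≤ X + Q := by simp only [X]; linarith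
    exact this.trans (by gcongr)
  rw [hG.resComp_eq hG' hx p]
  have hf := hN.abs_fRaw_le b hG hG' hx (b p.1) (b p.2)
  have hc := hN.abs_divCorr_le hG' hx (b p.1) (b p.2)
  have hf' : |fRaw b G G' x (b p.1) (b p.2)| ≤ 76 * n ^ 2 * N ^ 14 * (X + Q) := by
    calc _ ≤ 76 * n ^ 2 * N ^ 9 * (N ^ 3 * (X + Q)) * N * N := by
          refine hf.trans ?_; gcongr; exacts [hN.basis _, hN.basis _]
      _ = 76 * n ^ 2 * N ^ 14 * (X + Q) := by ring
  have hc' : |divCorr b G G' x (b p.1) (b p.2)| ≤ 20 * n ^ 2 * N ^ 14 * (X + Q) := by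
    calc _ ≤ 20 * n ^ 2 * N ^ 8 * (N ^ 3 * (X + Q)) * N * N := by
          refine hc.trans ?_; gcongr; exacts [hN.basis _, hN.basis _]
      _ = 20 * n ^ 2 * N ^ 13 * (X + Q) := by ring
      _ ≤ 20 * n ^ 2 * N ^ 14 * (X + Q) := by
          have h1314 : N ^ 13 ≤ N ^ 14 := hN.pow_le_pow (by norm_num)
          gcongr
  calc |fRaw b G G' x (b p.1) (b p.2) - divCorr b G G' x (b p.1) (b p.2)|
      ≤ |fRaw b G G' x (b p.1) (b p.2)| + |divCorr b G G' x (b p.1) (b p.2)| := abs_sub _ _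
    _ ≤ 76 * n ^ 2 * N ^ 14 * (X + Q) + 20 * n ^ 2 * N ^ 14 * (X + Q) := add_le_add hf' hc'
    _ = _ := by ring

omit [CompleteSpace E] in
/-- `|uPot| ≤ 6 n N¹⁰ Σ|A_t|`. [cite: Kotschwar2014, §1.1 (10)] -/
theorem PairBound.abs_uPot_le' (k l i : ι) :
    |uPot b G G' (b k) (b l) i x| ≤ 6 * (Fintype.card ι : ℝ) * N ^ 10 * ∑ t, |aComp b G G' x t| := by
  have h0 := hN.nonneg
  calc _ ≤ 6 * (Fintype.card ι : ℝ) * N ^ 5 * ‖chrDiff G G' x‖ * ‖b k‖ * ‖b l‖ := hN.abs_uPot_le _ _ i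
    _ ≤ 6 * (Fintype.card ι : ℝ) * N ^ 5 * (N ^ 3 * ∑ t, |aComp b G G' x t|) * N * N := by
        gcongr; exacts [hN.norm_chrDiff_le, hN.basis k, hN.basis l]
    _ = _ := by ring

omit [CompleteSpace E] in
/-- `|vPot| ≤ 2 n² N¹⁰ Σ|A_t|`. [cite: Kotschwar2014, §1.1 (10)] -/
theorem PairBound.abs_vPot_le' (l : ι) :
    |vPot b G G' (b l) x| ≤ 2 * (Fintype.card ι : ℝ) ^ 2 * N ^ 10 * ∑ t, |aComp b G G' x t| := by
  have h0 := hN.nonneg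
  calc _ ≤ 2 * (Fintype.card ι : ℝ) ^ 2 * N ^ 6 * ‖chrDiff G G' x‖ * ‖b l‖ := hN.abs_vPot_le _
    _ ≤ 2 * (Fintype.card ι : ℝ) ^ 2 * N ^ 6 * (N ^ 3 * ∑ t, |aComp b G G' x t|) * N := by
        gcongr; exacts [hN.norm_chrDiff_le, hN.basis l]
    _ = _ := by ring

/-- The `ℓ¹` size of the controlled quantities `X = Σ|H| + Σ|A| + Σ|P|`. [cite: Kotschwar2014, §2.3] -/
def l1X (b : Basis ι ℝ E) (G G' : E → E →L[ℝ] E →L[ℝ] ℝ) (x : E) : ℝ :=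
  ∑ p, |hComp b G G' x p| + ∑ t, |aComp b G G' x t| + ∑ p, |pComp b G G' x p|

/-- The `ℓ¹` size of the gradient `Q = Σ|∂P|`. [cite: Kotschwar2014, §2.3] -/
def l1Q (b : Basis ι ℝ E) (G G' : E → E →L[ℝ] E →L[ℝ] ℝ) (x : E) : ℝ := ∑ t, |dpComp b G G' x t|

omit hN in
omit [CompleteSpace E] in
/-- `0 ≤ X`. [folklore] -/
theorem l1X_nonneg : 0 ≤ l1X b G G' x := by unfold l1X; positivity

omit hN in
omit [CompleteSpace E] in
/-- `0 ≤ Q`. [folklore] -/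
theorem l1Q_nonneg : 0 ≤ l1Q b G G' x := by unfold l1Q; positivity

omit hN in
omit [CompleteSpace E] in
/-- `|H_p| ≤ X`. [folklore] -/
theorem abs_hComp_le (p : ι × ι) : |hComp b G G' x p| ≤ l1X b G G' x := by
  have h := abs_le_sum_abs (fun p ↦ hComp b G G' x p) p
  have hA : 0 ≤ ∑ t, |aComp b G G' x t| := Finset.sum_nonneg fun t _ ↦ abs_nonneg _
  have hP : 0 ≤ ∑ p, |pComp b G G' x p| := Finset.sum_nonneg fun p _ ↦ abs_nonneg _
  unfold l1X; linarith

omit hN in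
omit [CompleteSpace E] in
/-- `|A_t| ≤ X`. [folklore] -/
theorem abs_aComp_le (t : ι × ι × ι) : |aComp b G G' x t| ≤ l1X b G G' x := by
  have h := abs_le_sum_abs (fun t ↦ aComp b G G' x t) t
  have hH : 0 ≤ ∑ p, |hComp b G G' x p| := Finset.sum_nonneg fun p _ ↦ abs_nonneg _
  have hP : 0 ≤ ∑ p, |pComp b G G' x p| := Finset.sum_nonneg fun p _ ↦ abs_nonneg _
  unfold l1X; linarith

omit hN in
omit [CompleteSpace E] in
/-- `|P_p| ≤ X`. [folklore] -/
theorem abs_pComp_le (p : ι × ι) : |pComp b G G' x p| ≤ l1X b G G' x := by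
  have h := abs_le_sum_abs (fun p ↦ pComp b G G' x p) p
  have hH : 0 ≤ ∑ p, |hComp b G G' x p| := Finset.sum_nonneg fun p _ ↦ abs_nonneg _
  have hA : 0 ≤ ∑ t, |aComp b G G' x t| := Finset.sum_nonneg fun t _ ↦ abs_nonneg _
  unfold l1X; linarith

omit hN in
omit [CompleteSpace E] in
/-- `|dP_t| ≤ Q`. [folklore] -/
theorem abs_dpComp_le (t : ι × ι × ι) : |dpComp b G G' x t| ≤ l1Q b G G' x :=
  abs_le_sum_abs (fun t ↦ dpComp b G G' x t) t

omit hN in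
omit [CompleteSpace E] in
/-- `Σ|A_t| ≤ X`. [folklore] -/
theorem sum_abs_aComp_le : ∑ t, |aComp b G G' x t| ≤ l1X b G G' x := by
  have hH : 0 ≤ ∑ p, |hComp b G G' x p| := Finset.sum_nonneg fun p _ ↦ abs_nonneg _
  have hP : 0 ≤ ∑ p, |pComp b G G' x p| := Finset.sum_nonneg fun p _ ↦ abs_nonneg _
  unfold l1X; linarith

omit hN in
omit [CompleteSpace E] in
/-- `X² ≤ 3 n³ e`. [folklore] -/
theorem l1X_sq_le [Nonempty ι] : l1X b G G' x ^ 2 ≤ 3 * (Fintype.card ι : ℝ) ^ 3 * eDens b G G' x := by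
  set n : ℝ := (Fintype.card ι : ℝ) with hn
  have hn1 : 1 ≤ n := by rw [hn]; exact_mod_cast Fintype.card_pos
  have hcard2 : (Fintype.card (ι × ι) : ℝ) = n ^ 2 := by simp [hn, Fintype.card_prod]; ring
  have hcard3 : (Fintype.card (ι × ι × ι) : ℝ) = n ^ 3 := by simp [hn, Fintype.card_prod]; ring
  have hH := sq_sum_abs_le (fun p ↦ hComp b G G' x p)
  have hA := sq_sum_abs_le (fun t ↦ aComp b G G' x t)
  have hP := sq_sum_abs_le (fun p ↦ pComp b G G' x p)
  rw [hcard2] at hH hP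
  rw [hcard3] at hA
  have hn23 : n ^ 2 ≤ n ^ 3 := pow_le_pow_right₀ hn1 (by norm_num)
  have hs1 : 0 ≤ ∑ p, hComp b G G' x p ^ 2 := Finset.sum_nonneg fun p _ ↦ sq_nonneg _
  have hs3 : 0 ≤ ∑ p, pComp b G G' x p ^ 2 := Finset.sum_nonneg fun p _ ↦ sq_nonneg _
  have hsq : (∑ p, |hComp b G G' x p| + ∑ t, |aComp b G G' x t| + ∑ p, |pComp b G G' x p|) ^ 2 ≤
      3 * ((∑ p, |hComp b G G' x p|) ^ 2 + (∑ t, |aComp b G G' x t|) ^ 2 + (∑ p, |pComp b G G' x p|) ^ 2) := by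
    nlinarith [sq_nonneg (∑ p, |hComp b G G' x p| - ∑ t, |aComp b G G' x t|),
      sq_nonneg (∑ t, |aComp b G G' x t| - ∑ p, |pComp b G G' x p|),
      sq_nonneg (∑ p, |hComp b G G' x p| - ∑ p, |pComp b G G' x p|)]
  unfold l1X eDens
  nlinarith [mul_le_mul_of_nonneg_right hn23 hs1, mul_le_mul_of_nonneg_right hn23 hs3, hH, hA, hP, hsq]

omit hN in
omit [CompleteSpace E] in
/-- `Q² ≤ n³ q`. [folklore] -/
theorem l1Q_sq_le : l1Q b G G' x ^ 2 ≤ (Fintype.card ι : ℝ) ^ 3 * qDens b G G' x := by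
  have h := sq_sum_abs_le (fun t ↦ dpComp b G G' x t)
  have hcard3 : (Fintype.card (ι × ι × ι) : ℝ) = (Fintype.card ι : ℝ) ^ 3 := by simp [Fintype.card_prod]; ring
  rw [hcard3] at h
  exact h

/-- **Step B: `phi0 ≤ 250 n⁴N¹⁴ (ρ²X² + ρ²XQ)`.** [cite: Kotschwar2014, Prop. 7] -/
theorem PairBound.phi0_le [Nonempty ι] (hG : IsMetricOn G V) (hG' : IsMetricOn G' V) (hx : x ∈ V) (ρ : E → ℝ) :
    phi0 b G G' ρ x ≤ 250 * ((Fintype.card ι : ℝ) ^ 4 * N ^ 14) *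
      (ρ x ^ 2 * l1X b G G' x ^ 2 + ρ x ^ 2 * (l1X b G G' x * l1Q b G G' x)) := by
  have h0 := hN.nonneg
  have h1 := hN.one_le
  set n : ℝ := (Fintype.card ι : ℝ) with hn
  set X := l1X b G G' x with hX
  set Q := l1Q b G G' x with hQ
  have hn1 : 1 ≤ n := by rw [hn]; exact_mod_cast Fintype.card_pos
  have hn0 : 0 ≤ n := zero_le_one.trans hn1
  have hX0 : 0 ≤ X := l1X_nonneg
  have hQ0 : 0 ≤ Q := l1Q_nonneg
  have hcard2 : (Fintype.card (ι × ι) : ℝ) = n ^ 2 := by simp [hn, Fintype.card_prod]; ring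
  have hcard3 : (Fintype.card (ι × ι × ι) : ℝ) = n ^ 3 := by simp [hn, Fintype.card_prod]; ring
  have hh : ∀ p, |hComp b G G' x p| ≤ X := fun p ↦ abs_hComp_le p
  have ha : ∀ t, |aComp b G G' x t| ≤ X := fun t ↦ abs_aComp_le t
  have hp : ∀ p, |pComp b G G' x p| ≤ X := fun p ↦ abs_pComp_le p
  have hπ : ∀ t, |piComp b G G' x t| ≤ 27 * N ^ 11 * (X + Q) := fun t ↦ hN.abs_piComp_le hG hG' hx t
  have hres : ∀ p, |resComp b G G' x p| ≤ 96 * n ^ 2 * N ^ 14 * (X + Q) := fun p ↦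
    hN.abs_resComp_le hG hG' hx p
  have hS1 : |∑ p, 2 * hComp b G G' x p * (-2 * pComp b G G' x p)| ≤ n ^ 2 * (4 * X ^ 2) := by
    have key : ∀ p, |2 * hComp b G G' x p * (-2 * pComp b G G' x p)| ≤ 4 * X ^ 2 := by
      intro p
      rw [show 2 * hComp b G G' x p * (-2 * pComp b G G' x p) = -4 * (hComp b G G' x p * pComp b G G' x p) by ring,
        abs_mul, abs_mul, show |(-4 : ℝ)| = 4 by norm_num]
      have := mul_le_mul (hh p) (hp p) (abs_nonneg _) hX0
      nlinarith [this]
    have := abs_sum_le_card_mul _ key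
    rwa [hcard2] at this
  have hS2 : |∑ t, 2 * aComp b G G' x t * piComp b G G' x t| ≤ n ^ 3 * (54 * N ^ 11 * (X * (X + Q))) := by
    have key : ∀ t, |2 * aComp b G G' x t * piComp b G G' x t| ≤ 54 * N ^ 11 * (X * (X + Q)) := by
      intro t
      rw [abs_mul, abs_mul, abs_two]
      have := mul_le_mul (ha t) (hπ t) (abs_nonneg _) hX0
      nlinarith [this]
    have := abs_sum_le_card_mul _ key
    rwa [hcard3] at this
  have hS3 : |∑ p, 2 * pComp b G G' x p * resComp b G G' x p| ≤ n ^ 2 * (192 * n ^ 2 * N ^ 14 * (X * (X + Q))) := by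
    have key : ∀ p, |2 * pComp b G G' x p * resComp b G G' x p| ≤ 192 * n ^ 2 * N ^ 14 * (X * (X + Q)) := by
      intro p
      rw [abs_mul, abs_mul, abs_two]
      have := mul_le_mul (hp p) (hres p) (abs_nonneg _) hX0
      nlinarith [this]
    have := abs_sum_le_card_mul _ key
    rwa [hcard2] at this
  have hr2 : 0 ≤ ρ x ^ 2 := sq_nonneg _
  have hsum := (abs_add_le _ _).trans (add_le_add ((abs_add_le _ _).trans (add_le_add hS1 hS2)) hS3)
  have hXX : 0 ≤ X ^ 2 := sq_nonneg _
  have hXXQ : 0 ≤ X * (X + Q) := by positivity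
  -- `n² ≤ n⁴ N¹⁴`, `n³ N¹¹ ≤ n⁴ N¹⁴`
  have hc1 : n ^ 2 * 4 ≤ 4 * (n ^ 4 * N ^ 14) := by
    have h24 : n ^ 2 ≤ n ^ 4 := pow_le_pow_right₀ hn1 (by norm_num)
    have hN14 : (1 : ℝ) ≤ N ^ 14 := one_le_pow₀ h1
    nlinarith [mul_le_mul h24 hN14 zero_le_one (pow_nonneg hn0 4)]
  have hc2 : n ^ 3 * (54 * N ^ 11) ≤ 54 * (n ^ 4 * N ^ 14) := by
    have h34 : n ^ 3 ≤ n ^ 4 := pow_le_pow_right₀ hn1 (by norm_num)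
    have hN1114 : N ^ 11 ≤ N ^ 14 := hN.pow_le_pow (by norm_num)
    nlinarith [mul_le_mul h34 hN1114 (by positivity) (pow_nonneg hn0 4)]
  have step : |∑ p, 2 * hComp b G G' x p * (-2 * pComp b G G' x p)
        + ∑ t, 2 * aComp b G G' x t * piComp b G G' x t
        + ∑ p, 2 * pComp b G G' x p * resComp b G G' x p| ≤ 250 * (n ^ 4 * N ^ 14) * (X ^ 2 + X * Q) := by
    refine hsum.trans ?_
    have e : X * (X + Q) = X ^ 2 + X * Q := by ring
    rw [e] at *
    have hXQ : 0 ≤ X * Q := by positivity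
    nlinarith [mul_le_mul_of_nonneg_right hc1 hXX, mul_le_mul_of_nonneg_right hc2 (add_nonneg hXX hXQ),
      mul_nonneg (mul_nonneg (pow_nonneg hn0 4) (pow_nonneg h0 14)) hXQ]
  rw [phi0]
  calc ρ x ^ 2 * _ ≤ ρ x ^ 2 * |∑ p, 2 * hComp b G G' x p * (-2 * pComp b G G' x p)
        + ∑ t, 2 * aComp b G G' x t * piComp b G G' x t
        + ∑ p, 2 * pComp b G G' x p * resComp b G G' x p| :=
          mul_le_mul_of_nonneg_left (le_abs_self _) hr2
    _ ≤ ρ x ^ 2 * (250 * (n ^ 4 * N ^ 14) * (X ^ 2 + X * Q)) := mul_le_mul_of_nonneg_left step hr2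
    _ = _ := by ring

/-- **Step C: `phiPr ≤ −2λ ρ²q + 4 n⁴N¹⁴ R₁ |ρ| X Q + 2 n⁴N¹⁴ ρ² X Q`** (the good term).
[cite: Kotschwar2014, Prop. 7] -/
theorem PairBound.phiPr_le [Nonempty ι] (hG : IsMetricOn G V) (hx : x ∈ V) {ρ : E → ℝ} {lam R₁ : ℝ}
    (hell : ∀ ξ : ι → ℝ, lam * ∑ j, ξ j ^ 2 ≤ ∑ i, ∑ j, ginv G b x i j * ξ i * ξ j)
    (hdρ : ‖fderiv ℝ ρ x‖ ≤ R₁) :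
    phiPr b G G' ρ x ≤ -(2 * lam) * (ρ x ^ 2 * qDens b G G' x)
      + 4 * ((Fintype.card ι : ℝ) ^ 4 * N ^ 14) * R₁ * (|ρ x| * (l1X b G G' x * l1Q b G G' x))
      + 2 * ((Fintype.card ι : ℝ) ^ 4 * N ^ 14) * (ρ x ^ 2 * (l1X b G G' x * l1Q b G G' x)) := by
  have h0 := hN.nonneg
  have h1 := hN.one_le
  set n : ℝ := (Fintype.card ι : ℝ) with hn
  set X := l1X b G G' x with hX
  set Q := l1Q b G G' x with hQ
  set q := qDens b G G' x with hqdef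
  set r := ρ x with hr
  have hn0 : 0 ≤ n := by positivity
  have hX0 : 0 ≤ X := l1X_nonneg
  have hQ0 : 0 ≤ Q := l1Q_nonneg
  have hR₁ : 0 ≤ R₁ := (norm_nonneg _).trans hdρ
  have hcard2 : (Fintype.card (ι × ι) : ℝ) = n ^ 2 := by simp [hn, Fintype.card_prod]; ring
  have hp : ∀ p, |pComp b G G' x p| ≤ X := fun p ↦ abs_pComp_le p
  have hdp : ∀ t, |dpComp b G G' x t| ≤ Q := fun t ↦ abs_dpComp_le t
  have hdρi : ∀ i, |fderiv ℝ ρ x (b i)| ≤ R₁ * N := fun i ↦ hN.abs_fderiv_rho_le hdρ i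
  have hg : ∀ i j, |ginv G b x i j| ≤ N ^ 3 := fun i j ↦ hN.abs_ginv_le i j
  have hdg : ∀ i j, |dginv b G x (b i) i j| ≤ N ^ 6 := fun i j ↦ by
    rw [dginv, ← Real.norm_eq_abs]
    calc ‖coordCLM b i (fderiv ℝ (sharpAt G) x (b i) (coordCLM b j))‖
        ≤ ‖coordCLM b i‖ * (‖fderiv ℝ (sharpAt G) x (b i)‖ * ‖coordCLM b j‖) :=
          (le_opNorm _ _).trans (by gcongr; exact le_opNorm _ _)
      _ ≤ N * ((‖sharpAt G x‖ * ‖fderiv ℝ G x‖ * ‖sharpAt G x‖ * ‖b i‖) * N) := by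
          gcongr
          exacts [hN.coord i, hG.norm_fderiv_sharpAt_apply_le hx (b i), hN.coord j]
      _ ≤ N * ((N * N * N * N) * N) := by gcongr; exacts [hN.sharp, hN.dmetric, hN.sharp, hN.basis i]
      _ = N ^ 6 := by ring
  -- the three sums
  set T1 : ℝ := ∑ p : ι × ι, ∑ i, ∑ j, 4 * r * fderiv ℝ ρ x (b i) *
    (ginv G b x i j * pComp b G G' x p) * dpComp b G G' x (j, p) with hT1def
  set T2 : ℝ := ∑ p : ι × ι, ∑ i, ∑ j, 2 * r ^ 2 * (dginv b G x (b i) i j * pComp b G G' x p) *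
    dpComp b G G' x (j, p) with hT2def
  set T3 : ℝ := ∑ p : ι × ι, ∑ i, ∑ j, ginv G b x i j * dpComp b G G' x (i, p) * dpComp b G G' x (j, p)
    with hT3def
  have hPr_eq : phiPr b G G' ρ x = -(T1 + T2 + 2 * r ^ 2 * T3) := by
    rw [phiPr, hT1def, hT2def, hT3def, Finset.mul_sum, ← Finset.sum_add_distrib, ← Finset.sum_add_distrib]
    congr 1
    refine Finset.sum_congr rfl fun p _ ↦ ?_
    rw [Finset.mul_sum, ← Finset.sum_add_distrib, ← Finset.sum_add_distrib]
    refine Finset.sum_congr rfl fun i _ ↦ ?_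
    rw [Finset.mul_sum, ← Finset.sum_add_distrib, ← Finset.sum_add_distrib]
    refine Finset.sum_congr rfl fun j _ ↦ ?_
    rw [← hr]
    ring
  have hT3 : lam * q ≤ T3 := by
    have hq' : q = ∑ p : ι × ι, ∑ j, dpComp b G G' x (j, p) ^ 2 := by
      rw [hqdef, qDens, Fintype.sum_prod_type, Finset.sum_comm]
    rw [hq', Finset.mul_sum, hT3def]
    refine Finset.sum_le_sum fun p _ ↦ ?_
    refine (hell (fun i ↦ dpComp b G G' x (i, p))).trans (le_of_eq ?_)
    exact Finset.sum_congr rfl fun i _ ↦ Finset.sum_congr rfl fun j _ ↦ by ring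
  have hT1 : |T1| ≤ 4 * (n ^ 4 * N ^ 14) * R₁ * (|r| * (X * Q)) := by
    have hb : ∀ (p : ι × ι) i j, |4 * r * fderiv ℝ ρ x (b i) * (ginv G b x i j * pComp b G G' x p) *
        dpComp b G G' x (j, p)| ≤ 4 * |r| * (R₁ * N) * (N ^ 3 * X) * Q := by
      intro p i j
      rw [abs_mul, abs_mul, abs_mul, abs_mul, show |(4:ℝ)| = 4 by norm_num]
      have h1' := mul_le_mul (hg i j) (hp p) (abs_nonneg _) (by positivity)
      rw [← abs_mul] at h1'
      gcongr
      · exact hdρi i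
      · exact hdp _
    have hs := abs_sum_le_card_mul _ fun p ↦ abs_sum_le_card_mul _ fun i ↦ abs_sum_le_card_mul _ fun j ↦ hb p i j
    rw [hcard2] at hs
    have h414 : N ^ 4 ≤ N ^ 14 := hN.pow_le_pow (by norm_num)
    calc |T1| ≤ n ^ 2 * (n * (n * (4 * |r| * (R₁ * N) * (N ^ 3 * X) * Q))) := hs
      _ = 4 * (n ^ 4 * N ^ 4) * R₁ * (|r| * (X * Q)) := by rw [hn]; ring
      _ ≤ 4 * (n ^ 4 * N ^ 14) * R₁ * (|r| * (X * Q)) := by gcongr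
  have hT2 : |T2| ≤ 2 * (n ^ 4 * N ^ 14) * (r ^ 2 * (X * Q)) := by
    have hb : ∀ (p : ι × ι) i j, |2 * r ^ 2 * (dginv b G x (b i) i j * pComp b G G' x p) *
        dpComp b G G' x (j, p)| ≤ 2 * r ^ 2 * (N ^ 6 * X) * Q := by
      intro p i j
      rw [abs_mul, abs_mul, abs_mul, abs_two, abs_of_nonneg (sq_nonneg r)]
      have h1' := mul_le_mul (hdg i j) (hp p) (abs_nonneg _) (by positivity)
      rw [← abs_mul] at h1'
      gcongr
      exact hdp _
    have hs := abs_sum_le_card_mul _ fun p ↦ abs_sum_le_card_mul _ fun i ↦ abs_sum_le_card_mul _ fun j ↦ hb p i j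
    rw [hcard2] at hs
    have h614 : N ^ 6 ≤ N ^ 14 := hN.pow_le_pow (by norm_num)
    calc |T2| ≤ n ^ 2 * (n * (n * (2 * r ^ 2 * (N ^ 6 * X) * Q))) := hs
      _ = 2 * (n ^ 4 * N ^ 6) * (r ^ 2 * (X * Q)) := by rw [hn]; ring
      _ ≤ 2 * (n ^ 4 * N ^ 14) * (r ^ 2 * (X * Q)) := by gcongr
  rw [hPr_eq]
  have hr2 : 0 ≤ r ^ 2 := sq_nonneg _
  have h3 := mul_le_mul_of_nonneg_left hT3 hr2
  linarith [neg_abs_le T1, neg_abs_le T2, hT1, hT2, h3]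

omit [CompleteSpace E] in
/-- **Step D: `phiDv ≤ 40 n⁴N¹⁴ R₁ |ρ| X² + 20 n⁴N¹⁴ ρ² X Q`.** [cite: Kotschwar2014, Prop. 7] -/
theorem PairBound.phiDv_le [Nonempty ι] {ρ : E → ℝ} {R₁ : ℝ} (hdρ : ‖fderiv ℝ ρ x‖ ≤ R₁) :
    phiDv b G G' ρ x ≤ 40 * ((Fintype.card ι : ℝ) ^ 4 * N ^ 14) * R₁ * (|ρ x| * l1X b G G' x ^ 2)
      + 20 * ((Fintype.card ι : ℝ) ^ 4 * N ^ 14) * (ρ x ^ 2 * (l1X b G G' x * l1Q b G G' x)) := by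
  have h0 := hN.nonneg
  have h1 := hN.one_le
  set n : ℝ := (Fintype.card ι : ℝ) with hn
  set X := l1X b G G' x with hX
  set Q := l1Q b G G' x with hQ
  set r := ρ x with hr
  have hn1 : 1 ≤ n := by rw [hn]; exact_mod_cast Fintype.card_pos
  have hn0 : 0 ≤ n := by positivity
  have hX0 : 0 ≤ X := l1X_nonneg
  have hQ0 : 0 ≤ Q := l1Q_nonneg
  have hR₁ : 0 ≤ R₁ := (norm_nonneg _).trans hdρ
  have hcard2 : (Fintype.card (ι × ι) : ℝ) = n ^ 2 := by simp [hn, Fintype.card_prod]; ring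
  have hp : ∀ p, |pComp b G G' x p| ≤ X := fun p ↦ abs_pComp_le p
  have hdp : ∀ t, |dpComp b G G' x t| ≤ Q := fun t ↦ abs_dpComp_le t
  have hdρi : ∀ i, |fderiv ℝ ρ x (b i)| ≤ R₁ * N := fun i ↦ hN.abs_fderiv_rho_le hdρ i
  have hu : ∀ k l i, |uPot b G G' (b k) (b l) i x| ≤ 6 * n * N ^ 10 * X := fun k l i ↦
    (hN.abs_uPot_le' k l i).trans (by gcongr; exact sum_abs_aComp_le)
  have hv : ∀ l, |vPot b G G' (b l) x| ≤ 2 * n ^ 2 * N ^ 10 * X := fun l ↦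
    (hN.abs_vPot_le' l).trans (by gcongr; exact sum_abs_aComp_le)
  have hcoef : ∀ (p : ι × ι) (m : ι), |2 * ρ x * fderiv ℝ ρ x (b m) * (2 * pComp b G G' x p)
      + ρ x ^ 2 * (2 * dpComp b G G' x (m, p))| ≤ 4 * |r| * (R₁ * N) * X + 2 * r ^ 2 * Q := by
    intro p m
    rw [← hr]
    refine (abs_add_le _ _).trans (add_le_add ?_ ?_)
    · rw [show 2 * r * fderiv ℝ ρ x (b m) * (2 * pComp b G G' x p) = 4 * (r * (fderiv ℝ ρ x (b m) * pComp b G G' x p))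
        by ring, abs_mul, abs_mul, abs_mul, show |(4:ℝ)| = 4 by norm_num]
      have := mul_le_mul (hdρi m) (hp p) (abs_nonneg _) (by positivity)
      nlinarith [this, abs_nonneg r]
    · rw [abs_mul, abs_mul, abs_two, abs_of_nonneg (sq_nonneg _)]
      nlinarith [hdp (m, p), sq_nonneg r]
  have hcoef0 : 0 ≤ 4 * |r| * (R₁ * N) * X + 2 * r ^ 2 * Q := by positivity
  set Cf := 4 * |r| * (R₁ * N) * X + 2 * r ^ 2 * Q with hCf
  have key : ∀ p : ι × ι, |(∑ i, (2 * ρ x * fderiv ℝ ρ x (b i) * (2 * pComp b G G' x p)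
        + ρ x ^ 2 * (2 * dpComp b G G' x (i, p))) * uPot b G G' (b p.1) (b p.2) i x)
      + (2 * ρ x * fderiv ℝ ρ x (b p.1) * (2 * pComp b G G' x p)
        + ρ x ^ 2 * (2 * dpComp b G G' x (p.1, p))) * vPot b G G' (b p.2) x
      + (2 * ρ x * fderiv ℝ ρ x (b p.2) * (2 * pComp b G G' x p)
        + ρ x ^ 2 * (2 * dpComp b G G' x (p.2, p))) * vPot b G G' (b p.1) x|
      ≤ n * (Cf * (6 * n * N ^ 10 * X)) + 2 * (Cf * (2 * n ^ 2 * N ^ 10 * X)) := by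
    intro p
    have hU : |∑ i, (2 * ρ x * fderiv ℝ ρ x (b i) * (2 * pComp b G G' x p)
        + ρ x ^ 2 * (2 * dpComp b G G' x (i, p))) * uPot b G G' (b p.1) (b p.2) i x| ≤ n * (Cf * (6 * n * N ^ 10 * X)) := by
      have := abs_sum_le_card_mul _ fun i ↦ (show |(2 * ρ x * fderiv ℝ ρ x (b i) * (2 * pComp b G G' x p)
          + ρ x ^ 2 * (2 * dpComp b G G' x (i, p))) * uPot b G G' (b p.1) (b p.2) i x| ≤ Cf * (6 * n * N ^ 10 * X) by
        rw [abs_mul]; exact mul_le_mul (hcoef p i) (hu _ _ i) (abs_nonneg _) hcoef0)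
      rwa [← hn] at this
    have hV : |(2 * ρ x * fderiv ℝ ρ x (b p.1) * (2 * pComp b G G' x p)
        + ρ x ^ 2 * (2 * dpComp b G G' x (p.1, p))) * vPot b G G' (b p.2) x| ≤ Cf * (2 * n ^ 2 * N ^ 10 * X) := by
      rw [abs_mul]; exact mul_le_mul (hcoef p p.1) (hv p.2) (abs_nonneg _) hcoef0
    have hW : |(2 * ρ x * fderiv ℝ ρ x (b p.2) * (2 * pComp b G G' x p)
        + ρ x ^ 2 * (2 * dpComp b G G' x (p.2, p))) * vPot b G G' (b p.1) x| ≤ Cf * (2 * n ^ 2 * N ^ 10 * X) := by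
      rw [abs_mul]; exact mul_le_mul (hcoef p p.2) (hv p.1) (abs_nonneg _) hcoef0
    have := (abs_add_le _ _).trans (add_le_add ((abs_add_le _ _).trans (add_le_add hU hV)) hW)
    linarith
  have hDv : |phiDv b G G' ρ x| ≤ n ^ 2 * (n * (Cf * (6 * n * N ^ 10 * X)) + 2 * (Cf * (2 * n ^ 2 * N ^ 10 * X))) := by
    rw [phiDv, abs_neg]
    have := abs_sum_le_card_mul _ key
    rwa [hcard2] at this
  refine (le_abs_self _).trans (hDv.trans ?_)
  have e1 : n ^ 2 * (n * (Cf * (6 * n * N ^ 10 * X)) + 2 * (Cf * (2 * n ^ 2 * N ^ 10 * X)))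
      = 40 * (n ^ 4 * N ^ 11) * R₁ * (|r| * X ^ 2) + 20 * (n ^ 4 * N ^ 10) * (r ^ 2 * (X * Q)) := by rw [hCf]; ring
  rw [e1]
  have h1114 : N ^ 11 ≤ N ^ 14 := hN.pow_le_pow (by norm_num)
  have h1014 : N ^ 10 ≤ N ^ 14 := hN.pow_le_pow (by norm_num)
  gcongr

omit hN in
omit [Fintype ι] [FiniteDimensional ℝ E] [CompleteSpace E] in
/-- Step E of the pointwise estimate, pure arithmetic: the three bounds combine to
`Φ ≤ −2λ r²q + K₀(250R₀² + 40R₀R₁) X² + (K₀(272R₀ + 4R₁) + 1) |r| X Q`. [cite: Kotschwar2014, Prop. 7] -/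
theorem phi_combine_arith {φ₀ φ₁ φ₂ r X Q q K₀ R₀ R₁ lam : ℝ} (hK : 0 ≤ K₀) (hR₁ : 0 ≤ R₁)
    (hX : 0 ≤ X) (hQ : 0 ≤ Q) (hρx : |r| ≤ R₀)
    (hA : φ₀ ≤ 250 * K₀ * (r ^ 2 * X ^ 2 + r ^ 2 * (X * Q)))
    (hB : φ₁ ≤ -(2 * lam) * (r ^ 2 * q) + 4 * K₀ * R₁ * (|r| * (X * Q)) + 2 * K₀ * (r ^ 2 * (X * Q)))
    (hC : φ₂ ≤ 40 * K₀ * R₁ * (|r| * X ^ 2) + 20 * K₀ * (r ^ 2 * (X * Q))) :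
    φ₀ + φ₁ + φ₂ ≤ -(2 * lam) * (r ^ 2 * q) + K₀ * (250 * R₀ ^ 2 + 40 * R₀ * R₁) * X ^ 2
      + (K₀ * (272 * R₀ + 4 * R₁) + 1) * (|r| * (X * Q)) := by
  have hR₀ : 0 ≤ R₀ := (abs_nonneg r).trans hρx
  have hXX : 0 ≤ X ^ 2 := sq_nonneg _
  have hXQ : 0 ≤ X * Q := mul_nonneg hX hQ
  have hr2 : r ^ 2 ≤ R₀ ^ 2 := by
    calc r ^ 2 = |r| ^ 2 := (sq_abs r).symm
      _ ≤ R₀ ^ 2 := by gcongr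
  have hr2R : r ^ 2 ≤ R₀ * |r| := by
    calc r ^ 2 = |r| * |r| := by rw [← sq_abs]; ring
      _ ≤ R₀ * |r| := by gcongr
  have a1 : r ^ 2 * X ^ 2 ≤ R₀ ^ 2 * X ^ 2 := mul_le_mul_of_nonneg_right hr2 hXX
  have a2 : r ^ 2 * (X * Q) ≤ R₀ * (|r| * (X * Q)) := by
    calc r ^ 2 * (X * Q) ≤ (R₀ * |r|) * (X * Q) := mul_le_mul_of_nonneg_right hr2R hXQ
      _ = R₀ * (|r| * (X * Q)) := by ring
  have a3 : |r| * X ^ 2 ≤ R₀ * X ^ 2 := mul_le_mul_of_nonneg_right hρx hXX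
  have a4 : 0 ≤ |r| * (X * Q) := mul_nonneg (abs_nonneg r) hXQ
  have b1 := mul_le_mul_of_nonneg_left a1 (show 0 ≤ 250 * K₀ by positivity)
  have b2 := mul_le_mul_of_nonneg_left a2 (show 0 ≤ 250 * K₀ by positivity)
  have b3 := mul_le_mul_of_nonneg_left a3 (show 0 ≤ 40 * K₀ * R₁ by positivity)
  have b4 := mul_le_mul_of_nonneg_left a2 (show 0 ≤ 2 * K₀ by positivity)
  have b5 := mul_le_mul_of_nonneg_left a2 (show 0 ≤ 20 * K₀ by positivity)
  have e1 : K₀ * (250 * R₀ ^ 2 + 40 * R₀ * R₁) * X ^ 2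
      = 250 * K₀ * (R₀ ^ 2 * X ^ 2) + 40 * K₀ * R₁ * (R₀ * X ^ 2) := by ring
  have e2 : (K₀ * (272 * R₀ + 4 * R₁) + 1) * (|r| * (X * Q)) = 250 * K₀ * (R₀ * (|r| * (X * Q)))
      + 2 * K₀ * (R₀ * (|r| * (X * Q))) + 20 * K₀ * (R₀ * (|r| * (X * Q)))
      + 4 * K₀ * R₁ * (|r| * (X * Q)) + |r| * (X * Q) := by ring
  rw [e1, e2]
  linarith [hA, hB, hC, b1, b2, b3, b4, b5, a4]

omit hN in
omit [Fintype ι] [FiniteDimensional ℝ E] [CompleteSpace E] in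
/-- Steps F–G of the pointwise estimate, pure arithmetic (Young's inequality): if `Q² ≤ n³ q` then
`−2λ r²q + M₁ X² + M₂ |r| X Q ≤ (M₁ + M₂ (M₂ n³ + 1)/(4λ)) X²`. [cite: Kotschwar2014, Prop. 7] -/
theorem young_absorb_arith {Φ r X Q q n3 M₁ M₂ lam : ℝ} (hlam : 0 < lam) (hM₂ : 0 < M₂)
    (hn3 : 0 ≤ n3) (hX : 0 ≤ X) (hQ : 0 ≤ Q) (hq : 0 ≤ q) (hQq : Q ^ 2 ≤ n3 * q)
    (hcomb : Φ ≤ -(2 * lam) * (r ^ 2 * q) + M₁ * X ^ 2 + M₂ * (|r| * (X * Q))) :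
    Φ ≤ (M₁ + M₂ * ((M₂ * n3 + 1) / (4 * lam))) * X ^ 2 := by
  set δ := 2 * lam / (M₂ * n3 + 1) with hδ
  have hden : 0 < M₂ * n3 + 1 := by positivity
  have hδ0 : 0 < δ := by rw [hδ]; positivity
  have hr2 : 0 ≤ r ^ 2 := sq_nonneg _
  -- Young: `|r| X Q ≤ (δ/2) r² Q² + X²/(2δ) ≤ (δ/2) r² n³ q + X²/(2δ)`
  have hyoung : |r| * (X * Q) ≤ δ / 2 * (r ^ 2 * (n3 * q)) + 1 / (2 * δ) * X ^ 2 := by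
    have h := abs_mul_abs_le_young hδ0 (|r| * Q) X
    rw [abs_of_nonneg (mul_nonneg (abs_nonneg r) hQ), abs_of_nonneg hX, mul_pow, sq_abs] at h
    have hmono : δ / 2 * (r ^ 2 * Q ^ 2) ≤ δ / 2 * (r ^ 2 * (n3 * q)) := by gcongr
    calc |r| * (X * Q) = |r| * Q * X := by ring
      _ ≤ δ / 2 * (r ^ 2 * Q ^ 2) + 1 / (2 * δ) * X ^ 2 := h
      _ ≤ δ / 2 * (r ^ 2 * (n3 * q)) + 1 / (2 * δ) * X ^ 2 := by linarith
  -- `M₂ (δ/2) n³ ≤ λ` and `1/(2δ) = (M₂ n³ + 1)/(4λ)`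
  have hkey : M₂ * (δ / 2) * n3 ≤ lam := by
    have e : M₂ * (δ / 2) * n3 = lam * (M₂ * n3 / (M₂ * n3 + 1)) := by rw [hδ]; field_simp
    rw [e]
    have hfrac : M₂ * n3 / (M₂ * n3 + 1) ≤ 1 := by rw [div_le_one hden]; linarith
    exact (mul_le_mul_of_nonneg_left hfrac hlam.le).trans_eq (mul_one _)
  have hinv : 1 / (2 * δ) = (M₂ * n3 + 1) / (4 * lam) := by rw [hδ]; field_simp; ring
  have hr2q : 0 ≤ r ^ 2 * q := mul_nonneg hr2 hq
  have h1 : M₂ * (|r| * (X * Q)) ≤ M₂ * (δ / 2 * (r ^ 2 * (n3 * q))) + M₂ * (1 / (2 * δ) * X ^ 2) := by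
    have h := mul_le_mul_of_nonneg_left hyoung hM₂.le
    rwa [mul_add] at h
  have h2 : M₂ * (δ / 2 * (r ^ 2 * (n3 * q))) ≤ lam * (r ^ 2 * q) := by
    calc M₂ * (δ / 2 * (r ^ 2 * (n3 * q))) = (M₂ * (δ / 2) * n3) * (r ^ 2 * q) := by ring
      _ ≤ lam * (r ^ 2 * q) := mul_le_mul_of_nonneg_right hkey hr2q
  have h3 : M₂ * (1 / (2 * δ) * X ^ 2) = M₂ * ((M₂ * n3 + 1) / (4 * lam)) * X ^ 2 := by
    rw [hinv]; ring
  have h4 : 0 ≤ lam * (r ^ 2 * q) := mul_nonneg hlam.le hr2q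
  calc Φ ≤ -(2 * lam) * (r ^ 2 * q) + M₁ * X ^ 2 + M₂ * (|r| * (X * Q)) := hcomb
    _ ≤ -(2 * lam) * (r ^ 2 * q) + M₁ * X ^ 2 + (lam * (r ^ 2 * q) + M₂ * ((M₂ * n3 + 1) / (4 * lam)) * X ^ 2) := by
        linarith [h1, h2, h3]
    _ ≤ (M₁ + M₂ * ((M₂ * n3 + 1) / (4 * lam))) * X ^ 2 := by linarith [h4]

/-- **The pointwise estimate** (Kotschwar 2014, proof of Prop. 7): after integration by parts,
the integrand is bounded by `C · eDens` with `C = energyConst n N λ R₀ R₁`; the terms containing `∂P`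
are absorbed by the good term `−2λ ρ² |∂P|²` through Young's inequality. [cite: Kotschwar2014, Prop. 7] -/
theorem PairBound.phi_le [Nonempty ι] (hG : IsMetricOn G V) (hG' : IsMetricOn G' V) (hx : x ∈ V)
    {ρ : E → ℝ} {lam R₀ R₁ : ℝ} (hlam : 0 < lam)
    (hell : ∀ ξ : ι → ℝ, lam * ∑ j, ξ j ^ 2 ≤ ∑ i, ∑ j, ginv G b x i j * ξ i * ξ j)
    (hρx : |ρ x| ≤ R₀) (hdρ : ‖fderiv ℝ ρ x‖ ≤ R₁) :
    phi0 b G G' ρ x + phiPr b G G' ρ x + phiDv b G G' ρ x ≤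
      energyConst (Fintype.card ι) N lam R₀ R₁ * eDens b G G' x := by
  have h0 := hN.nonneg
  have hn0 : (0 : ℝ) ≤ (Fintype.card ι : ℝ) := by positivity
  have hX0 : 0 ≤ l1X b G G' x := l1X_nonneg
  have hQ0 : 0 ≤ l1Q b G G' x := l1Q_nonneg
  have he0 : 0 ≤ eDens b G G' x := by unfold eDens; positivity
  have hq0 : 0 ≤ qDens b G G' x := by unfold qDens; positivity
  have hR₀ : 0 ≤ R₀ := (abs_nonneg _).trans hρx
  have hR₁ : 0 ≤ R₁ := (norm_nonneg _).trans hdρ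
  have hK0 : 0 ≤ (Fintype.card ι : ℝ) ^ 4 * N ^ 14 := by positivity
  have hcomb := phi_combine_arith hK0 hR₁ hX0 hQ0 hρx (hN.phi0_le hG hG' hx ρ)
    (hN.phiPr_le hG hx hell hdρ) (hN.phiDv_le (ρ := ρ) hdρ)
  have hM₂ : 0 < (Fintype.card ι : ℝ) ^ 4 * N ^ 14 * (272 * R₀ + 4 * R₁) + 1 := by positivity
  have hfin := young_absorb_arith hlam hM₂ (pow_nonneg hn0 3) hX0 hQ0 hq0 l1Q_sq_le hcomb
  refine hfin.trans ((mul_le_mul_of_nonneg_left l1X_sq_le (by positivity)).trans (le_of_eq ?_))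
  rw [energyConst]
  ring

end Pointwise

/-! ### The localized energy inequality -/

section Main

variable [MeasurableSpace E] [BorelSpace E] {μ : Measure E} {ι : Type*} [Fintype ι] [FiniteDimensional ℝ E]
  [μ.IsAddHaarMeasure] [CompleteSpace E] {b : Basis ι ℝ E} {G G' : E → E →L[ℝ] E →L[ℝ] ℝ} {V : Set E}
  {ρ : E → ℝ} {x : E}

omit [MeasurableSpace E] [BorelSpace E] [μ.IsAddHaarMeasure] [CompleteSpace E] in
/-- Off the support of the cut-off, `phi0 = 0`. [folklore] -/
theorem phi0_eq_zero (hx : x ∉ tsupport ρ) : phi0 b G G' ρ x = 0 := by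
  simp [phi0, image_eq_zero_of_notMem_tsupport hx]

omit [MeasurableSpace E] [BorelSpace E] [μ.IsAddHaarMeasure] [CompleteSpace E] in
/-- Off the support of the cut-off, `phiPr = 0`. [folklore] -/
theorem phiPr_eq_zero (hx : x ∉ tsupport ρ) : phiPr b G G' ρ x = 0 := by
  simp [phiPr, image_eq_zero_of_notMem_tsupport hx]

omit [MeasurableSpace E] [BorelSpace E] [μ.IsAddHaarMeasure] [CompleteSpace E] in
/-- Off the support of the cut-off, `phiDv = 0`. [folklore] -/
theorem phiDv_eq_zero (hx : x ∉ tsupport ρ) : phiDv b G G' ρ x = 0 := by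
  simp [phiDv, image_eq_zero_of_notMem_tsupport hx]

omit [MeasurableSpace E] [BorelSpace E] [μ.IsAddHaarMeasure] in
/-- The energy density is continuous on `V`. [folklore] -/
theorem IsMetricOn.continuousOn_eDens (hG : IsMetricOn G V) (hG' : IsMetricOn G' V) :
    ContinuousOn (eDens b G G') V := by
  change ContinuousOn (fun y ↦ ∑ p, hComp b G G' y p ^ 2 + ∑ t, aComp b G G' y t ^ 2
    + ∑ p, pComp b G G' y p ^ 2) V
  refine ((continuousOn_finsetSum _ fun p _ ↦ ?_).add (continuousOn_finsetSum _ fun t _ ↦ ?_)).add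
    (continuousOn_finsetSum _ fun p _ ↦ ?_)
  · exact (hG.continuousOn_hComp hG' p).pow 2
  · exact (hG.continuousOn_aComp hG' t).pow 2
  · exact (hG.continuousOn_pComp hG' p).pow 2

omit [MeasurableSpace E] [BorelSpace E] [μ.IsAddHaarMeasure] [CompleteSpace E] in
/-- The energy density is nonnegative. [folklore] -/
theorem eDens_nonneg (y : E) : 0 ≤ eDens b G G' y := by unfold eDens; positivity

variable (hG : IsMetricOn G V) (hG' : IsMetricOn G' V) (hρ : ContDiff ℝ 1 ρ) (hρc : HasCompactSupport ρ)
  (hρV : tsupport ρ ⊆ V)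
include hG hG' hρ hρc hρV

/-- `phi0` is integrable. [folklore] -/
theorem integrable_phi0 : Integrable (phi0 b G G' ρ) μ := by
  have hV := hG.isOpen
  have hP := fun p ↦ hG.continuousOn_pComp (b := b) hG' p
  refine integrable_rhoSq_mul (μ := μ) hV hρ hρc hρV
    (u := fun x ↦ ∑ p, 2 * hComp b G G' x p * (-2 * pComp b G G' x p)
      + ∑ t, 2 * aComp b G G' x t * piComp b G G' x t
      + ∑ p, 2 * pComp b G G' x p * resComp b G G' x p) ?_
  refine ((continuousOn_finsetSum _ fun p _ ↦ ?_).add (continuousOn_finsetSum _ fun t _ ↦ ?_)).add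
    (continuousOn_finsetSum _ fun p _ ↦ ?_)
  · exact (continuousOn_const.mul (hG.continuousOn_hComp hG' p)).mul (continuousOn_const.mul (hP p))
  · exact (continuousOn_const.mul (hG.continuousOn_aComp hG' t)).mul (hG.continuousOn_piComp hG' t)
  · exact (continuousOn_const.mul (hP p)).mul (hG.continuousOn_resComp hG' p)

/-- `phiPr` is integrable. [folklore] -/
theorem integrable_phiPr : Integrable (phiPr b G G' ρ) μ := by
  have hV := hG.isOpen
  have hρ2 := fun {u : E → ℝ} (hu : ContinuousOn u V) ↦ integrable_rhoSq_mul (μ := μ) hV hρ hρc hρV hu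
  have hρ1 := fun {u : E → ℝ} (hu : ContinuousOn u V) (v : E) ↦
    integrable_rho_drho_mul (μ := μ) hV hρ hρc hρV hu v
  have hP := fun p ↦ hG.continuousOn_pComp (b := b) hG' p
  have hdP := fun t ↦ hG.continuousOn_dpComp (b := b) hG' t
  have hg := fun i j ↦ hG.continuousOn_ginv (b := b) i j
  have hdg := fun W i j ↦ hG.continuousOn_dginv (b := b) W i j
  have hintA' : ∀ (p : ι × ι) i j, Integrable (fun x ↦
      (2 * ρ x * fderiv ℝ ρ x (b i) * (2 * (ginv G b x i j * pComp b G G' x p))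
        + ρ x ^ 2 * (2 * (dginv b G x (b i) i j * pComp b G G' x p
          + ginv G b x i j * dpComp b G G' x (i, p)))) * dpComp b G G' x (j, p)) μ := by
    intro p i j
    have h1 := hρ1 (u := fun x ↦ 2 * (ginv G b x i j * pComp b G G' x p) * dpComp b G G' x (j, p))
      ((continuousOn_const.mul ((hg i j).mul (hP p))).mul (hdP (j, p))) (b i)
    have h2 := hρ2 (u := fun x ↦ 2 * (dginv b G x (b i) i j * pComp b G G' x p
        + ginv G b x i j * dpComp b G G' x (i, p)) * dpComp b G G' x (j, p))
      ((continuousOn_const.mul (((hdg (b i) i j).mul (hP p)).add ((hg i j).mul (hdP (i, p))))).mul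
        (hdP (j, p)))
    exact ((h1.const_mul 2).add h2).congr (Eventually.of_forall fun x ↦ by simp only [Pi.add_apply]; ring)
  have hsum : Integrable (fun x ↦ ∑ p : ι × ι, ∑ i, ∑ j,
      (2 * ρ x * fderiv ℝ ρ x (b i) * (2 * (ginv G b x i j * pComp b G G' x p))
        + ρ x ^ 2 * (2 * (dginv b G x (b i) i j * pComp b G G' x p
          + ginv G b x i j * dpComp b G G' x (i, p)))) * dpComp b G G' x (j, p)) μ :=
    integrable_finsetSum _ fun p _ ↦ integrable_finsetSum _ fun i _ ↦
      integrable_finsetSum _ fun j _ ↦ hintA' p i j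
  exact hsum.neg

/-- `phiDv` is integrable. [folklore] -/
theorem integrable_phiDv : Integrable (phiDv b G G' ρ) μ := by
  have hV := hG.isOpen
  have hρ2 := fun {u : E → ℝ} (hu : ContinuousOn u V) ↦ integrable_rhoSq_mul (μ := μ) hV hρ hρc hρV hu
  have hρ1 := fun {u : E → ℝ} (hu : ContinuousOn u V) (v : E) ↦
    integrable_rho_drho_mul (μ := μ) hV hρ hρc hρV hu v
  have hP := fun p ↦ hG.continuousOn_pComp (b := b) hG' p
  have hdP := fun t ↦ hG.continuousOn_dpComp (b := b) hG' t
  have hu : ∀ (p : ι × ι) i, ContinuousOn (uPot b G G' (b p.1) (b p.2) i) V := fun p i ↦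
    (hG.contDiffOn_uPot hG' _ _ i).continuousOn
  have hv : ∀ W : E, ContinuousOn (vPot b G G' W) V := fun W ↦ (hG.contDiffOn_vPot hG' W).continuousOn
  have hintW' : ∀ (p : ι × ι) (m : ι) {w : E → ℝ}, ContinuousOn w V → Integrable (fun x ↦
      (2 * ρ x * fderiv ℝ ρ x (b m) * (2 * pComp b G G' x p) + ρ x ^ 2 * (2 * dpComp b G G' x (m, p))) * w x) μ := by
    intro p m w hw
    have h1 := hρ1 (u := fun x ↦ 2 * pComp b G G' x p * w x) ((continuousOn_const.mul (hP p)).mul hw) (b m)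
    have h2 := hρ2 (u := fun x ↦ 2 * dpComp b G G' x (m, p) * w x) ((continuousOn_const.mul (hdP (m, p))).mul hw)
    exact ((h1.const_mul 2).add h2).congr (Eventually.of_forall fun x ↦ by simp only [Pi.add_apply]; ring)
  have hsum : Integrable (fun x ↦ ∑ p : ι × ι, ((∑ i,
        (2 * ρ x * fderiv ℝ ρ x (b i) * (2 * pComp b G G' x p)
          + ρ x ^ 2 * (2 * dpComp b G G' x (i, p))) * uPot b G G' (b p.1) (b p.2) i x)
      + (2 * ρ x * fderiv ℝ ρ x (b p.1) * (2 * pComp b G G' x p)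
          + ρ x ^ 2 * (2 * dpComp b G G' x (p.1, p))) * vPot b G G' (b p.2) x
      + (2 * ρ x * fderiv ℝ ρ x (b p.2) * (2 * pComp b G G' x p)
          + ρ x ^ 2 * (2 * dpComp b G G' x (p.2, p))) * vPot b G G' (b p.1) x)) μ :=
    integrable_finsetSum _ fun p _ ↦
      ((integrable_finsetSum _ fun i _ ↦ hintW' p i (hu p i)).add (hintW' p p.1 (hv _))).add
        (hintW' p p.2 (hv _))
  exact hsum.neg

/-- **The localized energy inequality** (Kotschwar 2014, Prop. 7, compact case `α = β = 0`, in a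
chart with a squared cut-off): if `N` bounds the background quantities of the pair `(G, G')` and
`λ > 0` is an ellipticity constant of `g^{ij}` on the support of the cut-off `ρ`, and
`|ρ| ≤ R₀`, `‖Dρ‖ ≤ R₁`, then

  `∫ ρ² (∂_t e) dμ ≤ C(n, N, λ, R₀, R₁) · ∫_{tsupport ρ} e dμ`,

`e = Σ H² + Σ A² + Σ P²` the energy density and `∂_t e = eDeriv` its formal time derivative along
the two Ricci flows. [cite: Kotschwar2014, §2.3, Prop. 7] -/
theorem integral_rhoSq_eDeriv_le [Nonempty ι] {N lam R₀ R₁ : ℝ} (hlam : 0 < lam)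
    (hN : ∀ x ∈ tsupport ρ, PairBound b G G' x N)
    (hell : ∀ x ∈ tsupport ρ, ∀ ξ : ι → ℝ, lam * ∑ j, ξ j ^ 2 ≤ ∑ i, ∑ j, ginv G b x i j * ξ i * ξ j)
    (hR₀ : ∀ x, |ρ x| ≤ R₀) (hR₁ : ∀ x, ‖fderiv ℝ ρ x‖ ≤ R₁) :
    ∫ x, ρ x ^ 2 * eDeriv b G G' x ∂μ ≤
      energyConst (Fintype.card ι) N lam R₀ R₁ * ∫ x in tsupport ρ, eDens b G G' x ∂μ := by
  set C := energyConst (Fintype.card ι) N lam R₀ R₁ with hCdef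
  have hR₀0 : 0 ≤ R₀ := (abs_nonneg _).trans (hR₀ 0)
  have hR₁0 : 0 ≤ R₁ := (norm_nonneg _).trans (hR₁ 0)
  have hC : 0 ≤ C := energyConst_nonneg _ hlam hR₀0 hR₁0
  have hK : IsCompact (tsupport ρ) := hρc
  have hKm : MeasurableSet (tsupport ρ) := (isClosed_tsupport ρ).measurableSet
  have hi0 := integrable_phi0 (μ := μ) (b := b) hG hG' hρ hρc hρV
  have hiP := integrable_phiPr (μ := μ) (b := b) hG hG' hρ hρc hρV
  have hiD := integrable_phiDv (μ := μ) (b := b) hG hG' hρ hρc hρV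
  have hint_e : IntegrableOn (eDens b G G') (tsupport ρ) μ :=
    ((hG.continuousOn_eDens hG').mono hρV).integrableOn_compact hK
  have hbound : Integrable (fun x ↦ C * (tsupport ρ).indicator (eDens b G G') x) μ :=
    ((integrable_indicator_iff hKm).2 hint_e).const_mul C
  -- the pointwise bound, on and off the support
  have hpt : ∀ x, phi0 b G G' ρ x + phiPr b G G' ρ x + phiDv b G G' ρ x ≤
      C * (tsupport ρ).indicator (eDens b G G') x := by
    intro x
    by_cases hx : x ∈ tsupport ρ
    · rw [indicator_of_mem hx]
      exact (hN x hx).phi_le hG hG' (hρV hx) hlam (hell x hx) (hR₀ x) (hR₁ x)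
    · rw [indicator_of_notMem hx, mul_zero, phi0_eq_zero hx, phiPr_eq_zero hx, phiDv_eq_zero hx,
        add_zero, add_zero]
  have hsplit : (∫ x, phi0 b G G' ρ x ∂μ) + (∫ x, phiPr b G G' ρ x ∂μ) + ∫ x, phiDv b G G' ρ x ∂μ =
      ∫ x, (phi0 b G G' ρ x + phiPr b G G' ρ x + phiDv b G G' ρ x) ∂μ := by
    have e1 : (fun x ↦ phi0 b G G' ρ x + phiPr b G G' ρ x + phiDv b G G' ρ x) =
        fun x ↦ (phi0 b G G' ρ + phiPr b G G' ρ) x + phiDv b G G' ρ x := rfl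
    rw [e1, integral_add (hi0.add hiP) hiD]
    congr 1
    exact (integral_add hi0 hiP).symm
  rw [integral_rhoSq_eDeriv_eq hG hG' hρ hρc hρV, hsplit]
  calc ∫ x, (phi0 b G G' ρ x + phiPr b G G' ρ x + phiDv b G G' ρ x) ∂μ
      ≤ ∫ x, C * (tsupport ρ).indicator (eDens b G G') x ∂μ :=
        integral_mono ((hi0.add hiP).add hiD) hbound hpt
    _ = C * ∫ x in tsupport ρ, eDens b G G' x ∂μ := by
        rw [integral_const_mul, integral_indicator hKm]

end Main





end MetricCoord

end Literature.Geometry.Lorentzian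

end
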